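import Literature.NumberTheory.EllipticCurves.GoodReductionInertia
import Literature.NumberTheory.EllipticCurves.ReductionHomomorphism
import HarnessLib

/-!
# The chord–tangent law in the chart at `O`: quantitative formal-group estimates for `E₁`

Topic `NumberTheory/EllipticCurves`. Let `(F, w)` be a valued field (`w : Valuation F ℝ≥0`) and
`V` a Weierstrass equation with `w`-integral coefficients (Mathlib `V.IsIntegral w.integer`, as
in `GoodReductionInertia`, `PointReduction`, `KernelReductionDivisibleProofs`). The *kernel of
reduction* `E₁(F)` is `O` together with the affine points `(x, y)` with `|x| > 1`; on it the
local parameter at `O` is `z = -x/y` (Silverman, *The Arithmetic of Elliptic Curves*, IV.1 and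
VII.2). Silverman proves (Prop. VII.2.2) that for complete `F` the map `z` is an isomorphism of
`E₁(F)` onto the group `Ê(𝓜)` of the FORMAL GROUP of `E` (IV.1–IV.3: the power series
`w(z)`, `F(z₁, z₂) = z₁ + z₂ - a₁z₁z₂ - ⋯`, `i(z)`), which is what makes the filtration
`E₁ ⊃ E₂ ⊃ ⋯` with quotients `≅ 𝓜ⁿ/𝓜ⁿ⁺¹` available (IV.3.2, VII.2.2). The tree has the formal
group law as a power series (`FormalGroupLaw.lean`) but not its convergence/evaluation at points
(`z(P + Q) = F(z(P), z(Q))` is a named fact, and only over `ℚ_p`).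

This file proves the two quantitative consequences of `z(P + Q) = F(z(P), z(Q))` that the
filtration arguments actually use, **directly from Mathlib's chord–tangent formulas and without
power series**, for every valued field and every integral equation:

* `val_zCoord_add_sub_le` — **first-order additivity**: `|z(P + Q) - z(P) - z(Q)| ≤
  max(|z(P)|, |z(Q)|)²` on `E₁` (so every level set `{|z| ≤ r}`, `{|z| < r}` is a subgroup and
  `z` induces a homomorphism `{|z| ≤ r} → {|a| ≤ r}/{|a| < r}`);
* `val_zCoord_add_sub_eq` — **translations are isometries**: `|z(P + Q) - z(P)| = |z(Q)|`
  (so `d(P, Q) = |z(P - Q)| = |z(P) - z(Q)|`, `val_zCoord_sub`, and `z` is an isometric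
  embedding of `E₁(F)` into the maximal ideal);

together with the structure they need: `WeierstrassCurve.Affine.Point.zCoord` (the parameter
`z`, a deliberate dot-notation extension of Mathlib's `WeierstrassCurve.Affine.Point`),
`kernel w V : AddSubgroup` (**`E₁` is a subgroup**, the tree's `ReducesToZero.add` of
`ReductionHomomorphism` in this language), `zCoord_injOn` (**`z` is injective on `E₁`**, by a
Vieta argument on the cubic `z₀³y³ + (1 - a₁z₀ - a₂z₀²)y² + (a₃ + a₄z₀)y - a₆` cut out by
`x = -z₀y`), and the facts about that cubic used to produce points of `E₁` with prescribed
parameter by root lifting (`equation_of_root`, `monic_cubic_eval`, `approxRoot`, `root_unique`: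
the monic form `v³ + uv² + tz₀³v - a₆z₀⁶` reduces to `v²(v + ū)`, its unit root is unique).
Surjectivity of `z` onto the maximal ideal (the other half of VII.2.2) needs Hensel's lemma and
is left to the consumers, which supply completeness or algebraic closedness.

## Method (Silverman, *AEC* IV.1, pp. 115–118, made finite)

For `P₁, P₂ ∈ E₁` with `P₁ ≠ -P₂` let `ℓ` be Mathlib's slope and `c = y₁ - ℓx₁` the
`Y`-intercept of the line through them (`c ≠ 0` on `E₁`). In the chart `z = -x/y`, `w = -1/y`
the line is `w = λz + ν`, `λ = -ℓ/c`, `ν = -1/c`, and Mathlib's factorisation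
`addPolynomial_slope` of the chord cubic gives, by Vieta and a Möbius change of variable, the
exact identity `z₁ + z₂ + z₃' = -c₂/c₃` for the third intersection (`sum_z_eq`; `c₂`, `c₃` as
in Silverman), uniformly in the chord and tangent cases. The slope is `λ = A/B` with `A, B`
the polynomials of the tree's `zw_chord` (chord) / the partial derivatives of the chart
equation (tangent) (`slope_data_of_X_ne`, `slope_data_of_X_eq`), `B`, `c₃` and
`1 - a₁z₃' - a₃w₃'` are units, and `z(P₁ + P₂) = -z₃'/(1 - a₁z₃' - a₃w₃')`. Every quantity
is then a rational function of `(z₁, w₁, z₂, w₂)` with unit denominator, estimated term by term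
(`chain`); the isometry statement compares with the degenerate configuration `P₂ → O`, whose
third intersection is `-P₁`.

## References

* [SilvermanAEC2009] J. H. Silverman, *The Arithmetic of Elliptic Curves*, 2nd ed., GTM 106,
  Springer 2009: IV.1 (pp. 115–118: `z = -x/y`, `w(z)`, `λ`, `ν`, `z₃ = -z₁ - z₂ - ⋯`,
  `F(z₁, z₂) = i(z₃(z₁, z₂))`), Prop. IV.3.2, VII.2 Props. VII.2.1–VII.2.2.

## Design

* No power series, no completeness: everything is an identity or an ultrametric estimate over an
  arbitrary valued field; `noncomputable section`, `open scoped Classical NNReal`, value group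
  `ℝ≥0` and integrality via `IsIntegral w.integer` as in `GoodReductionInertia`.
* The algebraic identities (`section Algebra`) are over any field and mention no valuation.
* `kernel w V` is phrased by `∀ x y h, P = some x y h → 1 < w x`, so that `O ∈ kernel` and the
  affine membership criterion `some_mem_kernel_iff` are definitional.
-/

noncomputable section

open scoped Classical NNReal

namespace Literature.NumberTheory.EllipticCurves

namespace FormalGroupChart

section Algebra

variable {F : Type*} [Field F] (W : WeierstrassCurve.Affine F)

/-- **Vieta for the chord/tangent cubic** (Mathlib `addPolynomial_slope`): with `ℓ` the slope,
`x₃ = addX` and `c = y₁ - ℓx₁`, the elementary symmetric functions `x₁x₂ + x₁x₃ + x₂x₃` and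
`x₁x₂x₃ = c² + a₃c - a₆` of the three intersections, in Mathlib's raw form. [folklore] -/
theorem vieta_of_slope {x₁ x₂ y₁ y₂ : F} (h₁ : W.Equation x₁ y₁) (h₂ : W.Equation x₂ y₂)
    (hxy : ¬(x₁ = x₂ ∧ y₁ = W.negY x₂ y₂)) :
    x₁ * x₂ + x₁ * W.addX x₁ x₂ (W.slope x₁ x₂ y₁ y₂) + x₂ * W.addX x₁ x₂ (W.slope x₁ x₂ y₁ y₂) =
        2 * x₁ * W.slope x₁ x₂ y₁ y₂ ^ 2 + (W.a₁ * x₁ - 2 * y₁ - W.a₃) * W.slope x₁ x₂ y₁ y₂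
          + (-W.a₁ * y₁ + W.a₄) ∧
      x₁ * x₂ * W.addX x₁ x₂ (W.slope x₁ x₂ y₁ y₂) =
        -(-x₁ ^ 2 * W.slope x₁ x₂ y₁ y₂ ^ 2 + (2 * x₁ * y₁ + W.a₃ * x₁) * W.slope x₁ x₂ y₁ y₂
          - (y₁ ^ 2 + W.a₃ * y₁ - W.a₆)) := by
  have key := WeierstrassCurve.Affine.addPolynomial_slope h₁ h₂ hxy
  rw [WeierstrassCurve.Affine.addPolynomial_eq, neg_inj, Cubic.prod_X_sub_C_eq,
    Cubic.toPoly_injective] at key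
  have hc := congrArg Cubic.c key
  have hd := congrArg Cubic.d key
  simp only at hc hd
  exact ⟨hc.symm, by linear_combination hd⟩

/-- **Vieta in the `(z, w)`-chart, denominator.** For the three intersections `(xᵢ, yᵢ)`,
`yᵢ = ℓxᵢ + c`, of the line `Y = ℓX + c` with a Weierstrass cubic:
`y₁y₂y₃ = c³ - a₂ℓc² + a₄ℓ²c - a₆ℓ³`. [folklore] -/
theorem prod_line_eq {x₁ x₂ x₃ ℓ c a₁ a₂ a₃ a₄ a₆ : F}
    (e₁ : x₁ + x₂ + x₃ = ℓ ^ 2 + a₁ * ℓ - a₂)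
    (e₂ : x₁ * x₂ + x₁ * x₃ + x₂ * x₃ = -(2 * ℓ * c + a₁ * c + a₃ * ℓ - a₄))
    (e₃ : x₁ * x₂ * x₃ = c ^ 2 + a₃ * c - a₆) :
    (ℓ * x₁ + c) * (ℓ * x₂ + c) * (ℓ * x₃ + c) =
      c ^ 3 - a₂ * ℓ * c ^ 2 + a₄ * ℓ ^ 2 * c - a₆ * ℓ ^ 3 := by
  linear_combination ℓ ^ 3 * e₃ + ℓ ^ 2 * c * e₂ + ℓ * c ^ 2 * e₁

/-- **Vieta in the `(z, w)`-chart, numerator**: `Σᵢ xᵢ ∏_{j ≠ i} yⱼ` in terms of `ℓ, c`. [folklore] -/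
theorem sum_mul_line_eq {x₁ x₂ x₃ ℓ c a₁ a₂ a₃ a₄ a₆ : F}
    (e₁ : x₁ + x₂ + x₃ = ℓ ^ 2 + a₁ * ℓ - a₂)
    (e₂ : x₁ * x₂ + x₁ * x₃ + x₂ * x₃ = -(2 * ℓ * c + a₁ * c + a₃ * ℓ - a₄))
    (e₃ : x₁ * x₂ * x₃ = c ^ 2 + a₃ * c - a₆) :
    x₁ * (ℓ * x₂ + c) * (ℓ * x₃ + c) + x₂ * (ℓ * x₁ + c) * (ℓ * x₃ + c)
        + x₃ * (ℓ * x₁ + c) * (ℓ * x₂ + c) =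
      a₃ * ℓ ^ 2 * c - 3 * a₆ * ℓ ^ 2 - a₁ * ℓ * c ^ 2 + 2 * a₄ * ℓ * c - a₂ * c ^ 2 := by
  linear_combination 3 * ℓ ^ 2 * e₃ + 2 * ℓ * c * e₂ + c ^ 2 * e₁

/-- **The `z`-coordinates `zᵢ = -xᵢ/yᵢ` of the three intersections of a line with the cubic sum
to `-c₂/c₃`**, where `λ = -ℓ/c`, `ν = -1/c` are the slope and intercept of the line in the
`(z, w)`-chart, `c₃ = 1 + a₂λ + a₄λ² + a₆λ³` and `c₂ = a₁λ + a₂ν + a₃λ² + 2a₄λν + 3a₆λ²ν`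
(Silverman, *AEC* IV.1, p. 117: substituting the line into the chart equation gives a cubic in
`z` with leading coefficient `c₃` and `z²`-coefficient `c₂`; here obtained from Vieta in the
`(x, y)`-chart through the Möbius transformation `z = -X/(ℓX + c)`, so that multiplicities need
no separate treatment). [cite: SilvermanAEC2009, IV.1] -/
theorem sum_z_eq {x₁ x₂ x₃ ℓ c a₁ a₂ a₃ a₄ a₆ : F}
    (e₁ : x₁ + x₂ + x₃ = ℓ ^ 2 + a₁ * ℓ - a₂)
    (e₂ : x₁ * x₂ + x₁ * x₃ + x₂ * x₃ = -(2 * ℓ * c + a₁ * c + a₃ * ℓ - a₄))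
    (e₃ : x₁ * x₂ * x₃ = c ^ 2 + a₃ * c - a₆) (hc : c ≠ 0)
    (hy₁ : ℓ * x₁ + c ≠ 0) (hy₂ : ℓ * x₂ + c ≠ 0) (hy₃ : ℓ * x₃ + c ≠ 0) :
    -x₁ / (ℓ * x₁ + c) + -x₂ / (ℓ * x₂ + c) + -x₃ / (ℓ * x₃ + c) =
      -(a₁ * (-ℓ / c) + a₂ * (-1 / c) + a₃ * (-ℓ / c) ^ 2 + 2 * a₄ * (-ℓ / c) * (-1 / c)
          + 3 * a₆ * (-ℓ / c) ^ 2 * (-1 / c)) /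
        (1 + a₂ * (-ℓ / c) + a₄ * (-ℓ / c) ^ 2 + a₆ * (-ℓ / c) ^ 3) := by
  have hD := prod_line_eq e₁ e₂ e₃
  have hN := sum_mul_line_eq e₁ e₂ e₃
  have hD' : (ℓ * x₁ + c) * (ℓ * x₂ + c) * (ℓ * x₃ + c) ≠ 0 :=
    mul_ne_zero (mul_ne_zero hy₁ hy₂) hy₃
  have hlhs : -x₁ / (ℓ * x₁ + c) + -x₂ / (ℓ * x₂ + c) + -x₃ / (ℓ * x₃ + c) =
      -(x₁ * (ℓ * x₂ + c) * (ℓ * x₃ + c) + x₂ * (ℓ * x₁ + c) * (ℓ * x₃ + c)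
        + x₃ * (ℓ * x₁ + c) * (ℓ * x₂ + c)) / ((ℓ * x₁ + c) * (ℓ * x₂ + c) * (ℓ * x₃ + c)) := by
    rw [div_add_div _ _ hy₁ hy₂, div_add_div _ _ (mul_ne_zero hy₁ hy₂) hy₃, div_eq_div_iff hD' hD']
    ring
  have hN3 : a₃ * ℓ ^ 2 * c - 3 * a₆ * ℓ ^ 2 - a₁ * ℓ * c ^ 2 + 2 * a₄ * ℓ * c - a₂ * c ^ 2 =
      c ^ 3 * (a₁ * (-ℓ / c) + a₂ * (-1 / c) + a₃ * (-ℓ / c) ^ 2 + 2 * a₄ * (-ℓ / c) * (-1 / c)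
          + 3 * a₆ * (-ℓ / c) ^ 2 * (-1 / c)) := by
    field_simp
    ring
  have hD3 : c ^ 3 - a₂ * ℓ * c ^ 2 + a₄ * ℓ ^ 2 * c - a₆ * ℓ ^ 3 =
      c ^ 3 * (1 + a₂ * (-ℓ / c) + a₄ * (-ℓ / c) ^ 2 + a₆ * (-ℓ / c) ^ 3) := by
    field_simp
    ring
  rw [hlhs, hN, hD, hN3, hD3, neg_mul_eq_mul_neg, mul_div_mul_left _ _ (pow_ne_zero 3 hc)]

end Algebra

section Ultrametric

variable {F : Type*} [Field F] (w : Valuation F ℝ≥0)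

/-- `|ab - a'b'| ≤ max(|a - a'|, |b - b'|)` when `|a|, |b'| ≤ 1`. [folklore] -/
theorem val_mul_sub_mul_le {a a' b b' : F} (ha : w a ≤ 1) (hb' : w b' ≤ 1) :
    w (a * b - a' * b') ≤ max (w (a - a')) (w (b - b')) := by
  have : a * b - a' * b' = a * (b - b') + (a - a') * b' := by ring
  rw [this]
  refine le_trans (w.map_add _ _) (max_le ?_ ?_)
  · rw [map_mul]
    calc w a * w (b - b') ≤ 1 * w (b - b') := by gcongr
      _ = w (b - b') := one_mul _
      _ ≤ max (w (a - a')) (w (b - b')) := le_max_right _ _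
  · rw [map_mul]
    calc w (a - a') * w b' ≤ w (a - a') * 1 := by gcongr
      _ = w (a - a') := mul_one _
      _ ≤ max (w (a - a')) (w (b - b')) := le_max_left _ _

/-- `|a/b - a'/b'| ≤ max(|a - a'|, |b - b'|)` when `|b| = |b'| = 1` and `|a'| ≤ 1`. [folklore] -/
theorem val_div_sub_div_le {a a' b b' : F} (hb : w b = 1) (hb' : w b' = 1) (ha' : w a' ≤ 1) :
    w (a / b - a' / b') ≤ max (w (a - a')) (w (b - b')) := by
  have hb0 : b ≠ 0 := fun h ↦ by rw [h, map_zero] at hb; exact zero_ne_one hb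
  have hb0' : b' ≠ 0 := fun h ↦ by rw [h, map_zero] at hb'; exact zero_ne_one hb'
  have : a / b - a' / b' = ((a - a') * b' + a' * (b' - b)) / (b * b') := by
    field_simp
    ring
  rw [this, map_div₀, map_mul, hb, hb', mul_one, div_one]
  refine le_trans (w.map_add _ _) (max_le ?_ ?_)
  · rw [map_mul, hb', mul_one]
    exact le_max_left _ _
  · rw [map_mul, ← Valuation.map_neg w (b' - b), neg_sub]
    calc w a' * w (b - b') ≤ 1 * w (b - b') := by gcongr
      _ = w (b - b') := one_mul _
      _ ≤ max (w (a - a')) (w (b - b')) := le_max_right _ _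

/-- A quantity congruent to `1` modulo the maximal ideal is a unit of absolute value `1`. [folklore] -/
theorem val_eq_one_of_val_sub_one_lt {b : F} (h : w (b - 1) < 1) : w b = 1 := by
  have : b = 1 + (b - 1) := by ring
  rw [this]
  exact w.map_one_add_of_lt h

/-- `|a b| ≤ s t` from `|a| ≤ s`, `|b| ≤ t`. [folklore] -/
theorem val_mul_le {a b : F} {s t : ℝ≥0} (ha : w a ≤ s) (hb : w b ≤ t) : w (a * b) ≤ s * t := by
  rw [map_mul]; exact mul_le_mul' ha hb

/-- `|a b c| ≤ s t u`. [folklore] -/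
theorem val_mul₃_le {a b c : F} {s t u : ℝ≥0} (ha : w a ≤ s) (hb : w b ≤ t) (hc : w c ≤ u) :
    w (a * b * c) ≤ s * t * u := by
  rw [map_mul, map_mul]; exact mul_le_mul' (mul_le_mul' ha hb) hc

end Ultrametric

section Sizes

variable {F : Type*} [Field F] {w : Valuation F ℝ≥0} {V : WeierstrassCurve F}

/-- **Sizes in the kernel of reduction** (Silverman, *AEC* VII.2.2 / IV.1: `x = z/w`, `y = -1/w`,
`w = z³(1 + ⋯)`): for an affine point `(x, y)` with `|x| > 1` on a `w`-integral equation,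
`y ≠ 0`, and with `r = |z|`, `z = -x/y`: `r < 1`, `|x|r² = 1`, `|y|r³ = 1`, `|-1/y| = r³`, `r > 0`.
[cite: SilvermanAEC2009, Prop. VII.2.2] -/
theorem val_zw [hV : V.IsIntegral w.integer] {x y : F} (he : V.toAffine.Equation x y)
    (hx : 1 < w x) :
    y ≠ 0 ∧ w (-x / y) < 1 ∧ w x * w (-x / y) ^ 2 = 1 ∧ w y * w (-x / y) ^ 3 = 1 ∧
      w (-1 / y) = w (-x / y) ^ 3 ∧ 0 < w (-x / y) := by
  have hsq := val_y_sq_eq he hx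
  obtain ⟨hxy, -⟩ := val_x_lt_val_y he hx
  have hx0 : (0 : ℝ≥0) < w x := lt_trans zero_lt_one hx
  have hy0 : (0 : ℝ≥0) < w y := hx0.trans hxy
  have hy : y ≠ 0 := fun h ↦ by rw [h, map_zero] at hy0; exact lt_irrefl _ hy0
  have hwy : w y ≠ 0 := hy0.ne'
  have hz : w (-x / y) = w x / w y := by rw [map_div₀, Valuation.map_neg]
  have hw : w (-1 / y) = (w y)⁻¹ := by rw [map_div₀, Valuation.map_neg, map_one, one_div]
  refine ⟨hy, ?_, ?_, ?_, ?_, ?_⟩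
  · rw [hz, div_lt_one hy0]; exact hxy
  · rw [hz, div_pow, mul_div_assoc', div_eq_one_iff_eq (pow_ne_zero 2 hwy), hsq]; ring
  · rw [hz, div_pow, mul_div_assoc', div_eq_one_iff_eq (pow_ne_zero 3 hwy)]
    calc w y * w x ^ 3 = w y * (w y) ^ 2 := by rw [← hsq]
      _ = w y ^ 3 := by ring
  · rw [hz, hw, div_pow, ← hsq, eq_div_iff (pow_ne_zero 3 hwy)]
    field_simp
  · rw [hz]; exact div_pos hx0 hy0

/-- On the `(z, w)`-curve `w = z³ + a₁zw + ⋯ + a₆w³` with integral `aᵢ`, a point with `|z| < 1`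
and `|w| < 1` has `|w| = |z|³` (the terms other than `z³` are `< |w|`). [folklore] -/
theorem val_w_eq_cube {z t a₁ a₂ a₃ a₄ a₆ : F}
    (h : t = z ^ 3 + a₁ * z * t + a₂ * z ^ 2 * t + a₃ * t ^ 2 + a₄ * z * t ^ 2 + a₆ * t ^ 3)
    (ha₁ : w a₁ ≤ 1) (ha₂ : w a₂ ≤ 1) (ha₃ : w a₃ ≤ 1) (ha₄ : w a₄ ≤ 1) (ha₆ : w a₆ ≤ 1)
    (hz : w z < 1) (ht : w t < 1) : w t = w z ^ 3 := by
  by_cases ht0 : t = 0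
  · subst ht0
    have : z ^ 3 = 0 := by linear_combination -h
    rw [pow_eq_zero_iff (by norm_num)] at this
    simp [this]
  have htpos : 0 < w t := (Valuation.pos_iff _).mpr ht0
  -- the non-cubic terms are `< w t`
  have hsmall : w (a₁ * z * t + a₂ * z ^ 2 * t + a₃ * t ^ 2 + a₄ * z * t ^ 2 + a₆ * t ^ 3) < w t := by
    have h1 : w (a₁ * z * t) < w t := by
      rw [map_mul, map_mul]
      calc w a₁ * w z * w t ≤ 1 * w z * w t := by gcongr
        _ = w z * w t := by rw [one_mul]
        _ < 1 * w t := by gcongr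
        _ = w t := one_mul _
    have h2 : w (a₂ * z ^ 2 * t) < w t := by
      rw [map_mul, map_mul, map_pow]
      calc w a₂ * w z ^ 2 * w t ≤ 1 * w z ^ 2 * w t := by gcongr
        _ = w z ^ 2 * w t := by rw [one_mul]
        _ < 1 * w t := by gcongr; exact pow_lt_one₀ zero_le hz two_ne_zero
        _ = w t := one_mul _
    have h3 : w (a₃ * t ^ 2) < w t := by
      rw [map_mul, map_pow]
      calc w a₃ * w t ^ 2 ≤ 1 * w t ^ 2 := by gcongr
        _ = w t * w t := by rw [one_mul, sq]
        _ < 1 * w t := by gcongr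
        _ = w t := one_mul _
    have h4 : w (a₄ * z * t ^ 2) < w t := by
      rw [map_mul, map_mul, map_pow]
      calc w a₄ * w z * w t ^ 2 ≤ 1 * 1 * w t ^ 2 := by gcongr
        _ = w t * w t := by rw [one_mul, one_mul, sq]
        _ < 1 * w t := by gcongr
        _ = w t := one_mul _
    have h6 : w (a₆ * t ^ 3) < w t := by
      rw [map_mul, map_pow]
      calc w a₆ * w t ^ 3 ≤ 1 * w t ^ 3 := by gcongr
        _ = w t ^ 2 * w t := by ring
        _ < 1 * w t := by gcongr; exact pow_lt_one₀ zero_le ht two_ne_zero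
        _ = w t := one_mul _
    exact w.map_add_lt (w.map_add_lt (w.map_add_lt (w.map_add_lt h1 h2) h3) h4) h6
  have key : w (t - (a₁ * z * t + a₂ * z ^ 2 * t + a₃ * t ^ 2 + a₄ * z * t ^ 2 + a₆ * t ^ 3)) =
      w t := w.map_sub_eq_of_lt_left hsmall
  have hz3 : t - (a₁ * z * t + a₂ * z ^ 2 * t + a₃ * t ^ 2 + a₄ * z * t ^ 2 + a₆ * t ^ 3) =
      z ^ 3 := by linear_combination h
  rw [hz3, map_pow] at key
  exact key.symm

end Sizes


section NatCast

variable {F : Type*} [Field F] (w : Valuation F ℝ≥0)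

/-- `|n| ≤ 1` for every natural number (valuations are non-archimedean). [folklore] -/
theorem val_natCast_le_one (n : ℕ) : w (n : F) ≤ 1 := by
  induction n with
  | zero => simp
  | succ n ih =>
    rw [Nat.cast_succ]
    exact w.map_add_le ih (le_of_eq w.map_one)

end NatCast

section Chain

variable {F : Type*} [Field F] {w : Valuation F ℝ≥0} {V : WeierstrassCurve F}
  [hV : V.IsIntegral w.integer]

set_option maxHeartbeats 1600000 in
/-- **The chord–tangent law in the chart at `O`, with estimates** (technical core; see
`val_add`, `val_zCoord_add_sub_le` and `val_zCoord_add_sub_eq` for the statements used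
later). Given the slope data `c ≠ 0`, `ℓ x₂ + c = y₂` and `λ = -ℓ/c = A/B` of the line
through two points `P₁, P₂` of the kernel of reduction (supplied by `slope_data_of_X_ne` /
`slope_data_of_X_eq` below in the chord and in the tangent case), the point `P₁ + P₂ = (x₃, y₃)` lies in the kernel of reduction and its parameter
`z₃ = -x₃/y₃` satisfies `|z₃ - z₁ - z₂| ≤ max(|z₁|, |z₂|)²` and `|z₃ - z₁| = |z₂|`.
(Silverman, *AEC* IV.1, pp. 116–118: `z₃ = -z₁ - z₂ - c₂/c₃` for the third intersection,
`F(z₁, z₂) = i(z₃)`; here every power series is replaced by the corresponding rational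
function with unit denominator and estimated term by term.) [cite: SilvermanAEC2009, IV.1] -/
theorem chain {x₁ y₁ x₂ y₂ : F} (h₁ : V.toAffine.Equation x₁ y₁) (h₂ : V.toAffine.Equation x₂ y₂)
    (hx₁ : 1 < w x₁) (hx₂ : 1 < w x₂) (hxy : ¬(x₁ = x₂ ∧ y₁ = V.toAffine.negY x₂ y₂))
    (hc0 : y₁ - V.toAffine.slope x₁ x₂ y₁ y₂ * x₁ ≠ 0)
    (hy₂ℓ : V.toAffine.slope x₁ x₂ y₁ y₂ * x₂ + (y₁ - V.toAffine.slope x₁ x₂ y₁ y₂ * x₁) = y₂)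
    (hlam : -V.toAffine.slope x₁ x₂ y₁ y₂ / (y₁ - V.toAffine.slope x₁ x₂ y₁ y₂ * x₁) =
      ((-x₁ / y₁) ^ 2 + (-x₁ / y₁) * (-x₂ / y₂) + (-x₂ / y₂) ^ 2 + V.a₁ * (-1 / y₁)
          + V.a₂ * ((-x₁ / y₁) + (-x₂ / y₂)) * (-1 / y₁) + V.a₄ * (-1 / y₁) ^ 2) /
        (1 - V.a₁ * (-x₂ / y₂) - V.a₂ * (-x₂ / y₂) ^ 2 - V.a₃ * ((-1 / y₁) + (-1 / y₂))
          - V.a₄ * (-x₂ / y₂) * ((-1 / y₁) + (-1 / y₂))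
          - V.a₆ * ((-1 / y₁) ^ 2 + (-1 / y₁) * (-1 / y₂) + (-1 / y₂) ^ 2))) :
    1 < w (V.toAffine.addX x₁ x₂ (V.toAffine.slope x₁ x₂ y₁ y₂)) ∧
    w (-V.toAffine.addX x₁ x₂ (V.toAffine.slope x₁ x₂ y₁ y₂) /
          V.toAffine.addY x₁ x₂ y₁ (V.toAffine.slope x₁ x₂ y₁ y₂) - -x₁ / y₁ - -x₂ / y₂) ≤
      max (w (-x₁ / y₁)) (w (-x₂ / y₂)) ^ 2 ∧
    w (-V.toAffine.addX x₁ x₂ (V.toAffine.slope x₁ x₂ y₁ y₂) /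
          V.toAffine.addY x₁ x₂ y₁ (V.toAffine.slope x₁ x₂ y₁ y₂) - -x₁ / y₁) = w (-x₂ / y₂) := by
  obtain ⟨hy₁0, hz₁lt, hxz₁, hyz₁, hw₁, hz₁pos⟩ := val_zw h₁ hx₁
  obtain ⟨hy₂0, hz₂lt, hxz₂, hyz₂, hw₂, hz₂pos⟩ := val_zw h₂ hx₂
  have ha₁ : w V.a₁ ≤ 1 := val_a₁_le_one
  have ha₂ : w V.a₂ ≤ 1 := val_a₂_le_one
  have ha₃ : w V.a₃ ≤ 1 := val_a₃_le_one
  have ha₄ : w V.a₄ ≤ 1 := val_a₄_le_one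
  have ha₆ : w V.a₆ ≤ 1 := val_a₆_le_one
  have h2 : w (2 : F) ≤ 1 := by exact_mod_cast val_natCast_le_one w 2
  have h3 : w (3 : F) ≤ 1 := by exact_mod_cast val_natCast_le_one w 3
  -- the chord–tangent data
  set ℓ := V.toAffine.slope x₁ x₂ y₁ y₂ with hℓ
  set c := y₁ - ℓ * x₁ with hc
  set x₃ := V.toAffine.addX x₁ x₂ ℓ with hx₃
  set y₃' := V.toAffine.negAddY x₁ x₂ y₁ ℓ with hy₃'def
  -- the chart
  set z₁ := -x₁ / y₁ with hz₁
  set t₁ := -1 / y₁ with ht₁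
  set z₂ := -x₂ / y₂ with hz₂
  set t₂ := -1 / y₂ with ht₂
  set r₁ := w z₁ with hr₁
  set r₂ := w z₂ with hr₂
  set R := max r₁ r₂ with hR
  have hr₁R : r₁ ≤ R := le_max_left _ _
  have hr₂R : r₂ ≤ R := le_max_right _ _
  have hR1 : R < 1 := max_lt hz₁lt hz₂lt
  have hRle : R ≤ 1 := hR1.le
  have hRpow : ∀ {m n : ℕ}, m ≤ n → R ^ n ≤ R ^ m := fun hmn ↦ pow_le_pow_of_le_one zero_le hRle hmn
  have ht₁R : w t₁ ≤ R ^ 3 := by rw [hw₁]; exact pow_le_pow_left₀ zero_le hr₁R 3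
  have ht₂R : w t₂ ≤ R ^ 3 := by rw [hw₂]; exact pow_le_pow_left₀ zero_le hr₂R 3
  have ht₂r : w t₂ ≤ r₂ := by
    rw [hw₂]; exact pow_le_of_le_one zero_le hz₂lt.le (by norm_num)
  have ht₁le1 : w t₁ ≤ 1 := ht₁R.trans (pow_le_one₀ zero_le hRle)
  have ht₂le1 : w t₂ ≤ 1 := ht₂R.trans (pow_le_one₀ zero_le hRle)
  have hz₁le1 : r₁ ≤ 1 := hz₁lt.le
  have hz₂le1 : r₂ ≤ 1 := hz₂lt.le
  have hz₁0 : z₁ ≠ 0 := (Valuation.pos_iff _).mp hz₁pos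
  have hz₂0 : z₂ ≠ 0 := (Valuation.pos_iff _).mp hz₂pos
  have hR3R2 : R ^ 3 ≤ R ^ 2 := hRpow (by norm_num)
  have hR2R : R ^ 2 ≤ R := by simpa using hRpow (m := 1) (n := 2) (by norm_num)
  have hR3R : R ^ 3 ≤ R := by simpa using hRpow (m := 1) (n := 3) (by norm_num)
  -- the equations in the chart
  have hzw₁ : t₁ = z₁ ^ 3 + V.a₁ * z₁ * t₁ + V.a₂ * z₁ ^ 2 * t₁ + V.a₃ * t₁ ^ 2
      + V.a₄ * z₁ * t₁ ^ 2 + V.a₆ * t₁ ^ 3 :=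
    WeierstrassCurve.Affine.equation_zw V.toAffine h₁ hy₁0
  -- `A`, `B`
  set A := z₁ ^ 2 + z₁ * z₂ + z₂ ^ 2 + V.a₁ * t₁ + V.a₂ * (z₁ + z₂) * t₁ + V.a₄ * t₁ ^ 2 with hA
  set B := 1 - V.a₁ * z₂ - V.a₂ * z₂ ^ 2 - V.a₃ * (t₁ + t₂) - V.a₄ * z₂ * (t₁ + t₂)
    - V.a₆ * (t₁ ^ 2 + t₁ * t₂ + t₂ ^ 2) with hB
  have hAR : w A ≤ R ^ 2 := by
    refine w.map_add_le (w.map_add_le (w.map_add_le (w.map_add_le (w.map_add_le ?_ ?_) ?_)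
      ?_) ?_) ?_
    · rw [map_pow]; exact pow_le_pow_left₀ zero_le hr₁R 2
    · calc w (z₁ * z₂) ≤ R * R := val_mul_le w hr₁R hr₂R
        _ = R ^ 2 := (sq R).symm
    · rw [map_pow]; exact pow_le_pow_left₀ zero_le hr₂R 2
    · calc w (V.a₁ * t₁) ≤ 1 * R ^ 3 := val_mul_le w ha₁ ht₁R
        _ = R ^ 3 := one_mul _
        _ ≤ R ^ 2 := hR3R2
    · calc w (V.a₂ * (z₁ + z₂) * t₁) ≤ 1 * 1 * R ^ 3 :=
          val_mul₃_le w ha₂ (w.map_add_le hz₁le1 hz₂le1) ht₁R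
        _ = R ^ 3 := by ring
        _ ≤ R ^ 2 := hR3R2
    · calc w (V.a₄ * t₁ ^ 2) ≤ 1 * R ^ 3 := val_mul_le w ha₄ (by
            rw [map_pow]
            calc w t₁ ^ 2 ≤ w t₁ := pow_le_of_le_one zero_le ht₁le1 two_ne_zero
              _ ≤ R ^ 3 := ht₁R)
        _ = R ^ 3 := one_mul _
        _ ≤ R ^ 2 := hR3R2
  have hB1 : w (B - 1) ≤ R := by
    have : B - 1 = -(V.a₁ * z₂ + V.a₂ * z₂ ^ 2 + V.a₃ * (t₁ + t₂) + V.a₄ * z₂ * (t₁ + t₂)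
      + V.a₆ * (t₁ ^ 2 + t₁ * t₂ + t₂ ^ 2)) := by rw [hB]; ring
    rw [this, Valuation.map_neg]
    have ht12 : w (t₁ + t₂) ≤ R ^ 3 := w.map_add_le ht₁R ht₂R
    refine w.map_add_le (w.map_add_le (w.map_add_le (w.map_add_le ?_ ?_) ?_) ?_) ?_
    · calc w (V.a₁ * z₂) ≤ 1 * R := val_mul_le w ha₁ hr₂R
        _ = R := one_mul _
    · calc w (V.a₂ * z₂ ^ 2) ≤ 1 * R ^ 2 := val_mul_le w ha₂ (by
            rw [map_pow]; exact pow_le_pow_left₀ zero_le hr₂R 2)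
        _ = R ^ 2 := one_mul _
        _ ≤ R := hR2R
    · calc w (V.a₃ * (t₁ + t₂)) ≤ 1 * R ^ 3 := val_mul_le w ha₃ ht12
        _ = R ^ 3 := one_mul _
        _ ≤ R := hR3R
    · calc w (V.a₄ * z₂ * (t₁ + t₂)) ≤ 1 * 1 * R ^ 3 := val_mul₃_le w ha₄ hz₂le1 ht12
        _ = R ^ 3 := by ring
        _ ≤ R := hR3R
    · calc w (V.a₆ * (t₁ ^ 2 + t₁ * t₂ + t₂ ^ 2)) ≤ 1 * R ^ 3 := val_mul_le w ha₆ (by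
            refine w.map_add_le (w.map_add_le ?_ ?_) ?_
            · rw [map_pow]
              exact (pow_le_of_le_one zero_le ht₁le1 two_ne_zero).trans ht₁R
            · calc w (t₁ * t₂) ≤ 1 * R ^ 3 := val_mul_le w ht₁le1 ht₂R
                _ = R ^ 3 := one_mul _
            · rw [map_pow]
              exact (pow_le_of_le_one zero_le ht₂le1 two_ne_zero).trans ht₂R)
        _ = R ^ 3 := one_mul _
        _ ≤ R := hR3R
  have hBw : w B = 1 := val_eq_one_of_val_sub_one_lt w (lt_of_le_of_lt hB1 hR1)
  have hB0 : B ≠ 0 := fun h ↦ by rw [h, map_zero] at hBw; exact zero_ne_one hBw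
  -- `λ`, `ν`
  set lam := -ℓ / c with hlam_def
  set nu := -1 / c with hnu_def
  have hlamR : w lam ≤ R ^ 2 := by rw [hlam, map_div₀, hBw, div_one]; exact hAR
  have hlamle1 : w lam ≤ 1 := hlamR.trans (pow_le_one₀ zero_le hRle)
  have hy₁ℓ : ℓ * x₁ + c = y₁ := by rw [hc]; ring
  have hline₁ : lam * z₁ + nu = t₁ := by
    rw [hlam_def, hnu_def, hz₁, ht₁]
    field_simp
    linear_combination hy₁ℓ
  have hline₂ : lam * z₂ + nu = t₂ := by
    rw [hlam_def, hnu_def, hz₂, ht₂]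
    field_simp
    linear_combination hy₂ℓ
  have hnu_eq : nu = t₁ - lam * z₁ := by linear_combination hline₁
  have hnuR : w nu ≤ R ^ 3 := by
    rw [hnu_eq]
    refine w.map_sub_le ht₁R ?_
    calc w (lam * z₁) ≤ R ^ 2 * R := val_mul_le w hlamR hr₁R
      _ = R ^ 3 := by ring
  have hnule1 : w nu ≤ 1 := hnuR.trans (pow_le_one₀ zero_le hRle)
  -- `c₂`, `c₃`
  set c₃ := 1 + V.a₂ * lam + V.a₄ * lam ^ 2 + V.a₆ * lam ^ 3 with hc₃
  set c₂ := V.a₁ * lam + V.a₂ * nu + V.a₃ * lam ^ 2 + 2 * V.a₄ * lam * nu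
    + 3 * V.a₆ * lam ^ 2 * nu with hc₂
  have hlam2 : w (lam ^ 2) ≤ R ^ 2 := by
    rw [map_pow]; exact (pow_le_of_le_one zero_le hlamle1 two_ne_zero).trans hlamR
  have hlam3 : w (lam ^ 3) ≤ R ^ 2 := by
    rw [map_pow]; exact (pow_le_of_le_one zero_le hlamle1 three_ne_zero).trans hlamR
  have hc₃1 : w (c₃ - 1) ≤ R ^ 2 := by
    have : c₃ - 1 = V.a₂ * lam + V.a₄ * lam ^ 2 + V.a₆ * lam ^ 3 := by rw [hc₃]; ring
    rw [this]
    refine w.map_add_le (w.map_add_le ?_ ?_) ?_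
    · simpa only [one_mul] using val_mul_le w ha₂ hlamR
    · simpa only [one_mul] using val_mul_le w ha₄ hlam2
    · simpa only [one_mul] using val_mul_le w ha₆ hlam3
  have hc₃w : w c₃ = 1 :=
    val_eq_one_of_val_sub_one_lt w (lt_of_le_of_lt hc₃1 (lt_of_le_of_lt hR2R hR1))
  have hc₃0 : c₃ ≠ 0 := fun h ↦ by rw [h, map_zero] at hc₃w; exact zero_ne_one hc₃w
  have hc₂R : w c₂ ≤ R ^ 2 := by
    refine w.map_add_le (w.map_add_le (w.map_add_le (w.map_add_le ?_ ?_) ?_) ?_) ?_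
    · simpa only [one_mul] using val_mul_le w ha₁ hlamR
    · calc w (V.a₂ * nu) ≤ 1 * R ^ 3 := val_mul_le w ha₂ hnuR
        _ = R ^ 3 := one_mul _
        _ ≤ R ^ 2 := hR3R2
    · simpa only [one_mul] using val_mul_le w ha₃ hlam2
    · calc w (2 * V.a₄ * lam * nu) ≤ 1 * 1 * R ^ 2 * 1 :=
          by rw [map_mul]; exact mul_le_mul' (val_mul₃_le w h2 ha₄ hlamR) hnule1
        _ = R ^ 2 := by ring
    · calc w (3 * V.a₆ * lam ^ 2 * nu) ≤ 1 * 1 * R ^ 2 * 1 :=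
          by rw [map_mul]; exact mul_le_mul' (val_mul₃_le w h3 ha₆ hlam2) hnule1
        _ = R ^ 2 := by ring
  have hc₂le1 : w c₂ ≤ 1 := hc₂R.trans (pow_le_one₀ zero_le hRle)
  -- Vieta
  have e₁ : x₁ + x₂ + x₃ = ℓ ^ 2 + V.a₁ * ℓ - V.a₂ := by
    rw [hx₃]; simp only [WeierstrassCurve.Affine.addX]; ring
  obtain ⟨e₂, e₃⟩ := vieta_of_slope V.toAffine h₁ h₂ hxy
  have e₂' : x₁ * x₂ + x₁ * x₃ + x₂ * x₃ = -(2 * ℓ * c + V.a₁ * c + V.a₃ * ℓ - V.a₄) := by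
    rw [e₂, hc]; ring
  have e₃' : x₁ * x₂ * x₃ = c ^ 2 + V.a₃ * c - V.a₆ := by
    rw [e₃, hc]; ring
  have hy₃' : ℓ * x₃ + c = y₃' := by
    change ℓ * x₃ + c = ℓ * (x₃ - x₁) + y₁
    rw [hc]; ring
  have hprod : y₁ * y₂ * y₃' = c ^ 3 * c₃ := by
    have := prod_line_eq e₁ e₂' e₃'
    rw [hy₁ℓ, hy₂ℓ, hy₃'] at this
    rw [this, hc₃, hlam_def]
    field_simp
    ring
  have hy₃'0 : y₃' ≠ 0 := by
    intro h
    have : c ^ 3 * c₃ = 0 := by rw [← hprod, h, mul_zero]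
    exact mul_ne_zero (pow_ne_zero 3 hc0) hc₃0 this
  set z₃' := -x₃ / y₃' with hz₃'
  set t₃' := -1 / y₃' with ht₃'
  have hsum : z₁ + z₂ + z₃' = -c₂ / c₃ := by
    have := sum_z_eq e₁ e₂' e₃' hc0 (hy₁ℓ ▸ hy₁0) (hy₂ℓ ▸ hy₂0) (hy₃' ▸ hy₃'0)
    rw [hy₁ℓ, hy₂ℓ, hy₃'] at this
    exact this
  have hsumR : w (z₁ + z₂ + z₃') ≤ R ^ 2 := by
    rw [hsum, map_div₀, Valuation.map_neg, hc₃w, div_one]; exact hc₂R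
  have hz₃'R : w z₃' ≤ R := by
    have : z₃' = (z₁ + z₂ + z₃') - z₁ - z₂ := by ring
    rw [this]
    exact w.map_sub_le (w.map_sub_le (hsumR.trans hR2R) hr₁R) hr₂R
  have hline₃ : lam * z₃' + nu = t₃' := by
    rw [hlam_def, hnu_def, hz₃', ht₃']
    field_simp
    linear_combination hy₃'
  have ht₃'R : w t₃' ≤ R ^ 3 := by
    rw [← hline₃]
    refine w.map_add_le ?_ hnuR
    calc w (lam * z₃') ≤ R ^ 2 * R := val_mul_le w hlamR hz₃'R
      _ = R ^ 3 := by ring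
  have hz₃'lt : w z₃' < 1 := lt_of_le_of_lt hz₃'R hR1
  have ht₃'lt : w t₃' < 1 := lt_of_le_of_lt (ht₃'R.trans hR3R) hR1
  -- the third point lies on the curve: `|t₃'| = |z₃'|³`
  have heq₃ : V.toAffine.Equation x₃ y₃' := WeierstrassCurve.Affine.equation_negAdd h₁ h₂ hxy
  have hzw₃ : t₃' = z₃' ^ 3 + V.a₁ * z₃' * t₃' + V.a₂ * z₃' ^ 2 * t₃' + V.a₃ * t₃' ^ 2
      + V.a₄ * z₃' * t₃' ^ 2 + V.a₆ * t₃' ^ 3 :=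
    WeierstrassCurve.Affine.equation_zw V.toAffine heq₃ hy₃'0
  have ht₃'eq : w t₃' = w z₃' ^ 3 := val_w_eq_cube hzw₃ ha₁ ha₂ ha₃ ha₄ ha₆ hz₃'lt ht₃'lt
  -- `x₃ ≠ 0`, hence `z₃' ≠ 0`
  have hcw : 1 < w c := by
    have hnu0 : nu ≠ 0 := by rw [hnu_def]; exact div_ne_zero (by norm_num) hc0
    have hwnu : w nu = (w c)⁻¹ := by rw [hnu_def, map_div₀, Valuation.map_neg, map_one, one_div]
    have hwnu1 : w nu < 1 := lt_of_le_of_lt (hnuR.trans hR3R) hR1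
    rw [hwnu] at hwnu1
    have hc' : w c ≠ 0 := (Valuation.ne_zero_iff _).mpr hc0
    exact (inv_lt_one₀ (pos_iff_ne_zero.mpr hc')).mp hwnu1
  have hx₃0 : x₃ ≠ 0 := by
    intro h0
    have hE : c ^ 2 + V.a₃ * c - V.a₆ = 0 := by rw [← e₃', h0, mul_zero]
    have hwE : w (c ^ 2 + V.a₃ * c - V.a₆) = w c ^ 2 := by
      rw [add_sub_assoc, w.map_add_eq_of_lt_left, map_pow]
      rw [map_pow]
      refine w.map_sub_lt ?_ ?_
      · rw [map_mul]
        calc w V.a₃ * w c ≤ 1 * w c := by gcongr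
          _ = w c := one_mul _
          _ < w c ^ 2 := lt_self_pow₀ hcw one_lt_two
      · exact lt_of_le_of_lt ha₆ (one_lt_pow₀ hcw two_ne_zero)
    rw [hE, map_zero] at hwE
    exact pow_ne_zero 2 (zero_lt_one.trans hcw).ne' hwE.symm
  have hz₃'0 : z₃' ≠ 0 := div_ne_zero (neg_ne_zero.mpr hx₃0) hy₃'0
  have hz₃'pos : 0 < w z₃' := (Valuation.pos_iff _).mpr hz₃'0
  -- (i) `P₁ + P₂` lies in the kernel of reduction
  have hx₃eq : x₃ = z₃' / t₃' := by rw [hz₃', ht₃']; field_simp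
  have hwx₃ : 1 < w x₃ := by
    rw [hx₃eq, map_div₀, ht₃'eq, one_lt_div (pow_pos hz₃'pos 3)]
    calc w z₃' ^ 3 = w z₃' ^ 2 * w z₃' := by ring
      _ < 1 * w z₃' := by gcongr; exact pow_lt_one₀ zero_le hz₃'lt two_ne_zero
      _ = w z₃' := one_mul _
  -- `u₃` and the `z`-coordinate of `P₁ + P₂`
  set u₃ := 1 - V.a₁ * z₃' - V.a₃ * t₃' with hu₃
  have hu₃1 : w (u₃ - 1) ≤ R := by
    have : u₃ - 1 = -(V.a₁ * z₃' + V.a₃ * t₃') := by rw [hu₃]; ring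
    rw [this, Valuation.map_neg]
    refine w.map_add_le ?_ ?_
    · simpa only [one_mul] using val_mul_le w ha₁ hz₃'R
    · calc w (V.a₃ * t₃') ≤ 1 * R ^ 3 := val_mul_le w ha₃ ht₃'R
        _ = R ^ 3 := one_mul _
        _ ≤ R := hR3R
  have hu₃w : w u₃ = 1 := val_eq_one_of_val_sub_one_lt w (lt_of_le_of_lt hu₃1 hR1)
  have hu₃0 : u₃ ≠ 0 := fun h ↦ by rw [h, map_zero] at hu₃w; exact zero_ne_one hu₃w
  have hy₃ : V.toAffine.addY x₁ x₂ y₁ ℓ = -y₃' * u₃ := by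
    change V.toAffine.negY x₃ y₃' = -y₃' * u₃
    simp only [WeierstrassCurve.Affine.negY]
    rw [hu₃, hz₃', ht₃']
    field_simp
    ring
  have hz₃ : -x₃ / V.toAffine.addY x₁ x₂ y₁ ℓ = -z₃' / u₃ := by
    rw [hy₃, hz₃']
    field_simp
  rw [hz₃]
  refine ⟨hwx₃, ?_, ?_⟩
  · -- (ii) first-order additivity
    have hsplit : -z₃' / u₃ - z₁ - z₂ = z₃' * (u₃ - 1) / u₃ - (z₁ + z₂ + z₃') := by
      field_simp
      ring
    rw [hsplit]
    refine w.map_sub_le ?_ hsumR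
    rw [map_div₀, hu₃w, div_one]
    calc w (z₃' * (u₃ - 1)) ≤ R * R := val_mul_le w hz₃'R hu₃1
      _ = R ^ 2 := (sq R).symm
  · -- (iii) the translation is an isometry: compare with the degenerate configuration `P₂ → O`
    set A₀ := z₁ ^ 2 + V.a₁ * t₁ + V.a₂ * z₁ * t₁ + V.a₄ * t₁ ^ 2 with hA₀
    set B₀ := 1 - V.a₃ * t₁ - V.a₆ * t₁ ^ 2 with hB₀
    have hB₀1 : w (B₀ - 1) ≤ R := by
      have : B₀ - 1 = -(V.a₃ * t₁ + V.a₆ * t₁ ^ 2) := by rw [hB₀]; ring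
      rw [this, Valuation.map_neg]
      refine w.map_add_le ?_ ?_
      · calc w (V.a₃ * t₁) ≤ 1 * R ^ 3 := val_mul_le w ha₃ ht₁R
          _ = R ^ 3 := one_mul _
          _ ≤ R := hR3R
      · calc w (V.a₆ * t₁ ^ 2) ≤ 1 * R ^ 3 := val_mul_le w ha₆ (by
              rw [map_pow]; exact (pow_le_of_le_one zero_le ht₁le1 two_ne_zero).trans ht₁R)
          _ = R ^ 3 := one_mul _
          _ ≤ R := hR3R
    have hB₀w : w B₀ = 1 := val_eq_one_of_val_sub_one_lt w (lt_of_le_of_lt hB₀1 hR1)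
    have hB₀0 : B₀ ≠ 0 := fun h ↦ by rw [h, map_zero] at hB₀w; exact zero_ne_one hB₀w
    have hA₀R : w A₀ ≤ R ^ 2 := by
      refine w.map_add_le (w.map_add_le (w.map_add_le ?_ ?_) ?_) ?_
      · rw [map_pow]; exact pow_le_pow_left₀ zero_le hr₁R 2
      · calc w (V.a₁ * t₁) ≤ 1 * R ^ 3 := val_mul_le w ha₁ ht₁R
          _ = R ^ 3 := one_mul _
          _ ≤ R ^ 2 := hR3R2
      · calc w (V.a₂ * z₁ * t₁) ≤ 1 * 1 * R ^ 3 := val_mul₃_le w ha₂ hz₁le1 ht₁R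
          _ = R ^ 3 := by ring
          _ ≤ R ^ 2 := hR3R2
      · calc w (V.a₄ * t₁ ^ 2) ≤ 1 * R ^ 3 := val_mul_le w ha₄ (by
              rw [map_pow]; exact (pow_le_of_le_one zero_le ht₁le1 two_ne_zero).trans ht₁R)
          _ = R ^ 3 := one_mul _
          _ ≤ R ^ 2 := hR3R2
    have hA₀le1 : w A₀ ≤ 1 := hA₀R.trans (pow_le_one₀ zero_le hRle)
    set lam₀ := A₀ / B₀ with hlam₀_def
    have hlam₀ : lam₀ = t₁ / z₁ := by
      rw [hlam₀_def, div_eq_div_iff hB₀0 hz₁0, hA₀, hB₀]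
      linear_combination -hzw₁
    have hlam₀R : w lam₀ ≤ R ^ 2 := by rw [hlam₀_def, map_div₀, hB₀w, div_one]; exact hA₀R
    have hlam₀le1 : w lam₀ ≤ 1 := hlam₀R.trans (pow_le_one₀ zero_le hRle)
    -- variations, with `s = r₂`
    have hRr : R * r₂ ≤ r₂ := by
      calc R * r₂ ≤ 1 * r₂ := by gcongr
        _ = r₂ := one_mul _
    have hΔA : w (A - A₀) ≤ R * r₂ := by
      have : A - A₀ = z₁ * z₂ + z₂ ^ 2 + V.a₂ * z₂ * t₁ := by rw [hA, hA₀]; ring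
      rw [this]
      refine w.map_add_le (w.map_add_le ?_ ?_) ?_
      · exact val_mul_le w hr₁R le_rfl
      · calc w (z₂ ^ 2) = r₂ * r₂ := by rw [map_pow, sq]
          _ ≤ R * r₂ := by gcongr
      · calc w (V.a₂ * z₂ * t₁) ≤ 1 * r₂ * R ^ 3 := val_mul₃_le w ha₂ le_rfl ht₁R
          _ = R ^ 3 * r₂ := by ring
          _ ≤ R * r₂ := by gcongr
    have hΔB : w (B - B₀) ≤ r₂ := by
      have : B - B₀ = -(V.a₁ * z₂ + V.a₂ * z₂ ^ 2 + V.a₃ * t₂ + V.a₄ * z₂ * (t₁ + t₂)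
        + V.a₆ * (t₁ * t₂ + t₂ ^ 2)) := by rw [hB, hB₀]; ring
      rw [this, Valuation.map_neg]
      refine w.map_add_le (w.map_add_le (w.map_add_le (w.map_add_le ?_ ?_) ?_) ?_) ?_
      · simpa only [one_mul] using val_mul_le w ha₁ (le_refl r₂)
      · calc w (V.a₂ * z₂ ^ 2) ≤ 1 * r₂ := val_mul_le w ha₂ (by
            rw [map_pow]; exact pow_le_of_le_one zero_le hz₂le1 two_ne_zero)
          _ = r₂ := one_mul _
      · simpa only [one_mul] using val_mul_le w ha₃ ht₂r
      · calc w (V.a₄ * z₂ * (t₁ + t₂)) ≤ 1 * r₂ * 1 :=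
            val_mul₃_le w ha₄ le_rfl (w.map_add_le ht₁le1 ht₂le1)
          _ = r₂ := by ring
      · calc w (V.a₆ * (t₁ * t₂ + t₂ ^ 2)) ≤ 1 * r₂ := val_mul_le w ha₆ (by
            refine w.map_add_le ?_ ?_
            · simpa only [one_mul] using val_mul_le w ht₁le1 ht₂r
            · rw [map_pow]; exact (pow_le_of_le_one zero_le ht₂le1 two_ne_zero).trans ht₂r)
          _ = r₂ := one_mul _
    have hΔlam : w (lam - lam₀) ≤ R * r₂ := by
      have : lam - lam₀ = ((A - A₀) * B₀ - A₀ * (B - B₀)) / (B * B₀) := by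
        rw [hlam, hlam₀_def]
        field_simp
        ring
      rw [this, map_div₀, map_mul, hBw, hB₀w, mul_one, div_one]
      refine w.map_sub_le ?_ ?_
      · calc w ((A - A₀) * B₀) ≤ R * r₂ * 1 := val_mul_le w hΔA hB₀w.le
          _ = R * r₂ := mul_one _
      · calc w (A₀ * (B - B₀)) ≤ R ^ 2 * r₂ := val_mul_le w hA₀R hΔB
          _ ≤ R * r₂ := by gcongr
    have hnu_eq' : nu = -(lam - lam₀) * z₁ := by
      have ht₁' : lam₀ * z₁ = t₁ := by rw [hlam₀]; field_simp
      linear_combination hline₁ - ht₁'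
    have hnuRr : w nu ≤ R * r₂ := by
      rw [hnu_eq', neg_mul, Valuation.map_neg]
      calc w ((lam - lam₀) * z₁) ≤ R * r₂ * 1 := val_mul_le w hΔlam hz₁le1
        _ = R * r₂ := mul_one _
    set c₃₀ := 1 + V.a₂ * lam₀ + V.a₄ * lam₀ ^ 2 + V.a₆ * lam₀ ^ 3 with hc₃₀
    set c₂₀ := V.a₁ * lam₀ + V.a₃ * lam₀ ^ 2 with hc₂₀
    have hlam₀2 : w (lam₀ ^ 2) ≤ R ^ 2 := by
      rw [map_pow]; exact (pow_le_of_le_one zero_le hlam₀le1 two_ne_zero).trans hlam₀R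
    have hlam₀3 : w (lam₀ ^ 3) ≤ R ^ 2 := by
      rw [map_pow]; exact (pow_le_of_le_one zero_le hlam₀le1 three_ne_zero).trans hlam₀R
    have hc₃₀1 : w (c₃₀ - 1) ≤ R ^ 2 := by
      have : c₃₀ - 1 = V.a₂ * lam₀ + V.a₄ * lam₀ ^ 2 + V.a₆ * lam₀ ^ 3 := by rw [hc₃₀]; ring
      rw [this]
      refine w.map_add_le (w.map_add_le ?_ ?_) ?_
      · simpa only [one_mul] using val_mul_le w ha₂ hlam₀R
      · simpa only [one_mul] using val_mul_le w ha₄ hlam₀2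
      · simpa only [one_mul] using val_mul_le w ha₆ hlam₀3
    have hc₃₀w : w c₃₀ = 1 :=
      val_eq_one_of_val_sub_one_lt w (lt_of_le_of_lt hc₃₀1 (lt_of_le_of_lt hR2R hR1))
    have hc₃₀0 : c₃₀ ≠ 0 := fun h ↦ by rw [h, map_zero] at hc₃₀w; exact zero_ne_one hc₃₀w
    have hc₂₀R : w c₂₀ ≤ R ^ 2 := by
      refine w.map_add_le ?_ ?_
      · simpa only [one_mul] using val_mul_le w ha₁ hlam₀R
      · simpa only [one_mul] using val_mul_le w ha₃ hlam₀2
    have hc₂₀le1 : w c₂₀ ≤ 1 := hc₂₀R.trans (pow_le_one₀ zero_le hRle)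
    -- differences of powers of `λ`
    have hΔlam2 : w (lam ^ 2 - lam₀ ^ 2) ≤ R * r₂ := by
      have : lam ^ 2 - lam₀ ^ 2 = (lam - lam₀) * (lam + lam₀) := by ring
      rw [this]
      calc w ((lam - lam₀) * (lam + lam₀)) ≤ R * r₂ * 1 :=
          val_mul_le w hΔlam (w.map_add_le hlamle1 hlam₀le1)
        _ = R * r₂ := mul_one _
    have hΔlam3 : w (lam ^ 3 - lam₀ ^ 3) ≤ R * r₂ := by
      have : lam ^ 3 - lam₀ ^ 3 = (lam - lam₀) * (lam ^ 2 + lam * lam₀ + lam₀ ^ 2) := by ring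
      rw [this]
      calc w ((lam - lam₀) * (lam ^ 2 + lam * lam₀ + lam₀ ^ 2)) ≤ R * r₂ * 1 :=
          val_mul_le w hΔlam (w.map_add_le (w.map_add_le
            (by rw [map_pow]; exact pow_le_one₀ zero_le hlamle1)
            (by simpa only [one_mul] using val_mul_le w hlamle1 hlam₀le1))
            (by rw [map_pow]; exact pow_le_one₀ zero_le hlam₀le1))
        _ = R * r₂ := mul_one _
    have hΔc₂ : w (c₂ - c₂₀) ≤ R * r₂ := by
      have : c₂ - c₂₀ = V.a₁ * (lam - lam₀) + V.a₂ * nu + V.a₃ * (lam ^ 2 - lam₀ ^ 2)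
          + 2 * V.a₄ * lam * nu + 3 * V.a₆ * lam ^ 2 * nu := by rw [hc₂, hc₂₀]; ring
      rw [this]
      refine w.map_add_le (w.map_add_le (w.map_add_le (w.map_add_le ?_ ?_) ?_) ?_) ?_
      · simpa only [one_mul] using val_mul_le w ha₁ hΔlam
      · simpa only [one_mul] using val_mul_le w ha₂ hnuRr
      · simpa only [one_mul] using val_mul_le w ha₃ hΔlam2
      · have h24 : w (2 * V.a₄ * lam * nu) ≤ 1 * 1 * 1 * (R * r₂) := by
          rw [map_mul]; exact mul_le_mul' (val_mul₃_le w h2 ha₄ hlamle1) hnuRr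
        simpa only [one_mul] using h24
      · have h36 : w (3 * V.a₆ * lam ^ 2 * nu) ≤ 1 * 1 * 1 * (R * r₂) := by
          rw [map_mul]
          exact mul_le_mul' (val_mul₃_le w h3 ha₆
            (by rw [map_pow]; exact pow_le_one₀ zero_le hlamle1)) hnuRr
        simpa only [one_mul] using h36
    have hΔc₃ : w (c₃ - c₃₀) ≤ R * r₂ := by
      have : c₃ - c₃₀ = V.a₂ * (lam - lam₀) + V.a₄ * (lam ^ 2 - lam₀ ^ 2)
          + V.a₆ * (lam ^ 3 - lam₀ ^ 3) := by rw [hc₃, hc₃₀]; ring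
      rw [this]
      refine w.map_add_le (w.map_add_le ?_ ?_) ?_
      · simpa only [one_mul] using val_mul_le w ha₂ hΔlam
      · simpa only [one_mul] using val_mul_le w ha₄ hΔlam2
      · simpa only [one_mul] using val_mul_le w ha₆ hΔlam3
    have hΔq : w (c₂ / c₃ - c₂₀ / c₃₀) ≤ R * r₂ :=
      (val_div_sub_div_le w hc₃w hc₃₀w hc₂₀le1).trans (max_le hΔc₂ hΔc₃)
    -- the degenerate third point `z₃₀ = z(-P₁)`, `t₃₀ = w(-P₁)`
    set z₃₀ := -z₁ - c₂₀ / c₃₀ with hz₃₀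
    set u₁ := 1 - V.a₁ * z₁ - V.a₃ * t₁ with hu₁
    have hu₁1 : w (u₁ - 1) ≤ R := by
      have : u₁ - 1 = -(V.a₁ * z₁ + V.a₃ * t₁) := by rw [hu₁]; ring
      rw [this, Valuation.map_neg]
      refine w.map_add_le ?_ ?_
      · simpa only [one_mul] using val_mul_le w ha₁ hr₁R
      · calc w (V.a₃ * t₁) ≤ 1 * R ^ 3 := val_mul_le w ha₃ ht₁R
          _ = R ^ 3 := one_mul _
          _ ≤ R := hR3R
    have hu₁w : w u₁ = 1 := val_eq_one_of_val_sub_one_lt w (lt_of_le_of_lt hu₁1 hR1)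
    have hu₁0 : u₁ ≠ 0 := fun h ↦ by rw [h, map_zero] at hu₁w; exact zero_ne_one hu₁w
    have hz₃₀eq : z₃₀ = -z₁ / u₁ := by
      -- Silverman's `z(-P) = -z/(1 - a₁ z - a₃ w)` as the degenerate third intersection
      have hC3 : z₁ ^ 3 * c₃₀ = t₁ * u₁ := by
        rw [hc₃₀, hlam₀, hu₁]
        field_simp
        linear_combination -hzw₁
      have hC2 : z₁ ^ 3 * c₂₀ = z₁ * t₁ * (V.a₁ * z₁ + V.a₃ * t₁) := by
        rw [hc₂₀, hlam₀]
        field_simp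
      have hq : c₂₀ / c₃₀ = z₁ * (V.a₁ * z₁ + V.a₃ * t₁) / u₁ := by
        rw [div_eq_div_iff hc₃₀0 hu₁0]
        have e1 := congrArg (· * (z₁ * (V.a₁ * z₁ + V.a₃ * t₁))) hC3
        have e2 := congrArg (· * u₁) hC2
        apply mul_left_cancel₀ (pow_ne_zero 3 hz₁0)
        linear_combination e2 - e1
      rw [hz₃₀, hq, eq_div_iff hu₁0]
      field_simp
      rw [hu₁]
      ring
    have hz₃₀R : w z₃₀ = r₁ := by
      rw [hz₃₀eq, map_div₀, Valuation.map_neg, hu₁w, div_one]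
    set t₃₀ := lam₀ * z₃₀ with ht₃₀
    have ht₃₀eq : t₃₀ = -t₁ / u₁ := by
      rw [ht₃₀, hlam₀, hz₃₀eq]
      field_simp
    set u₃₀ := 1 - V.a₁ * z₃₀ - V.a₃ * t₃₀ with hu₃₀
    have hu₃₀eq : u₃₀ = 1 / u₁ := by
      rw [hu₃₀, hz₃₀eq, ht₃₀eq, eq_div_iff hu₁0]
      field_simp
      rw [hu₁]
      ring
    have hu₃₀w : w u₃₀ = 1 := by rw [hu₃₀eq, map_div₀, map_one, hu₁w, div_one]
    have hfin : -z₃₀ / u₃₀ = z₁ := by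
      rw [hz₃₀eq, hu₃₀eq]
      field_simp
    -- the variations of the third point
    have hΔz_small : w (z₃' - z₃₀ + z₂) < r₂ := by
      have : z₃' - z₃₀ + z₂ = -(c₂ / c₃ - c₂₀ / c₃₀) := by
        rw [hz₃₀]
        linear_combination hsum
      rw [this, Valuation.map_neg]
      refine lt_of_le_of_lt hΔq ?_
      calc R * r₂ < 1 * r₂ := by gcongr
        _ = r₂ := one_mul _
    have hΔz : w (z₃' - z₃₀) = r₂ := by
      have : z₃' - z₃₀ = (z₃' - z₃₀ + z₂) + -z₂ := by ring
      rw [this, w.map_add_eq_of_lt_right (by rwa [Valuation.map_neg]), Valuation.map_neg]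
    have hΔzle : w (z₃' - z₃₀) ≤ r₂ := hΔz.le
    have hΔt : w (t₃' - t₃₀) ≤ r₂ := by
      have : t₃' - t₃₀ = lam * (z₃' - z₃₀) + (lam - lam₀) * z₃₀ + nu := by
        rw [ht₃₀]; linear_combination -hline₃
      rw [this]
      refine w.map_add_le (w.map_add_le ?_ ?_) (hnuRr.trans hRr)
      · calc w (lam * (z₃' - z₃₀)) ≤ 1 * r₂ := val_mul_le w hlamle1 hΔzle
          _ = r₂ := one_mul _
      · calc w ((lam - lam₀) * z₃₀) ≤ R * r₂ * 1 :=
            val_mul_le w hΔlam (by rw [hz₃₀R]; exact hz₁le1)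
          _ = R * r₂ := mul_one _
          _ ≤ r₂ := hRr
    have hΔu : w (u₃ - u₃₀) ≤ r₂ := by
      have : u₃ - u₃₀ = -(V.a₁ * (z₃' - z₃₀) + V.a₃ * (t₃' - t₃₀)) := by
        rw [hu₃, hu₃₀]; ring
      rw [this, Valuation.map_neg]
      refine w.map_add_le ?_ ?_
      · simpa only [one_mul] using val_mul_le w ha₁ hΔzle
      · simpa only [one_mul] using val_mul_le w ha₃ hΔt
    -- conclusion
    have hu₃₀0 : u₃₀ ≠ 0 := fun h ↦ by rw [h, map_zero] at hu₃₀w; exact zero_ne_one hu₃₀w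
    have hkey : -z₃' / u₃ - z₁ = -(((z₃' - z₃₀) * u₃₀ + z₃₀ * (u₃₀ - u₃)) / (u₃ * u₃₀)) := by
      conv_lhs => rw [← hfin]
      field_simp
      ring
    rw [hkey, Valuation.map_neg, map_div₀, map_mul, hu₃w, hu₃₀w, mul_one, div_one,
      w.map_add_eq_of_lt_left]
    · rw [map_mul, hΔz, hu₃₀w, mul_one]
    · rw [map_mul, map_mul, hΔz, hu₃₀w, mul_one, hz₃₀R, ← Valuation.map_neg w (u₃₀ - u₃),
        neg_sub]
      calc r₁ * w (u₃ - u₃₀) ≤ r₁ * r₂ := by gcongr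
        _ < 1 * r₂ := by gcongr
        _ = r₂ := one_mul _

end Chain

end FormalGroupChart

end Literature.NumberTheory.EllipticCurves

namespace Literature.NumberTheory.EllipticCurves

namespace FormalGroupChart

section SlopeData

variable {F : Type*} [Field F] {w : Valuation F ℝ≥0} {V : WeierstrassCurve F}
  [hV : V.IsIntegral w.integer]

/-- `|B - 1| ≤ max(|z₁|, |z₂|)` for the denominator `B` of the slope in the chart. [folklore] -/
theorem val_B_sub_one_le {z₂ t₁ t₂ : F} {R : ℝ≥0} (hRle : R ≤ 1) (hz₂ : w z₂ ≤ R)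
    (ht₁ : w t₁ ≤ R ^ 3) (ht₂ : w t₂ ≤ R ^ 3) :
    w (1 - V.a₁ * z₂ - V.a₂ * z₂ ^ 2 - V.a₃ * (t₁ + t₂) - V.a₄ * z₂ * (t₁ + t₂)
        - V.a₆ * (t₁ ^ 2 + t₁ * t₂ + t₂ ^ 2) - 1) ≤ R := by
  have ha₁ : w V.a₁ ≤ 1 := val_a₁_le_one
  have ha₂ : w V.a₂ ≤ 1 := val_a₂_le_one
  have ha₃ : w V.a₃ ≤ 1 := val_a₃_le_one
  have ha₄ : w V.a₄ ≤ 1 := val_a₄_le_one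
  have ha₆ : w V.a₆ ≤ 1 := val_a₆_le_one
  have hR3R : R ^ 3 ≤ R := pow_le_of_le_one zero_le hRle three_ne_zero
  have hR2R : R ^ 2 ≤ R := pow_le_of_le_one zero_le hRle two_ne_zero
  have hR3le1 : R ^ 3 ≤ 1 := pow_le_one₀ zero_le hRle
  have ht₁le1 : w t₁ ≤ 1 := ht₁.trans hR3le1
  have ht₂le1 : w t₂ ≤ 1 := ht₂.trans hR3le1
  have hz₂le1 : w z₂ ≤ 1 := hz₂.trans hRle
  have ht12 : w (t₁ + t₂) ≤ R ^ 3 := w.map_add_le ht₁ ht₂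
  have : 1 - V.a₁ * z₂ - V.a₂ * z₂ ^ 2 - V.a₃ * (t₁ + t₂) - V.a₄ * z₂ * (t₁ + t₂)
      - V.a₆ * (t₁ ^ 2 + t₁ * t₂ + t₂ ^ 2) - 1 = -(V.a₁ * z₂ + V.a₂ * z₂ ^ 2 + V.a₃ * (t₁ + t₂)
      + V.a₄ * z₂ * (t₁ + t₂) + V.a₆ * (t₁ ^ 2 + t₁ * t₂ + t₂ ^ 2)) := by ring
  rw [this, Valuation.map_neg]
  refine w.map_add_le (w.map_add_le (w.map_add_le (w.map_add_le ?_ ?_) ?_) ?_) ?_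
  · simpa only [one_mul] using val_mul_le w ha₁ hz₂
  · calc w (V.a₂ * z₂ ^ 2) ≤ 1 * R ^ 2 := val_mul_le w ha₂ (by
          rw [map_pow]; exact pow_le_pow_left₀ zero_le hz₂ 2)
      _ = R ^ 2 := one_mul _
      _ ≤ R := hR2R
  · calc w (V.a₃ * (t₁ + t₂)) ≤ 1 * R ^ 3 := val_mul_le w ha₃ ht12
      _ = R ^ 3 := one_mul _
      _ ≤ R := hR3R
  · calc w (V.a₄ * z₂ * (t₁ + t₂)) ≤ 1 * 1 * R ^ 3 := val_mul₃_le w ha₄ hz₂le1 ht12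
      _ = R ^ 3 := by ring
      _ ≤ R := hR3R
  · calc w (V.a₆ * (t₁ ^ 2 + t₁ * t₂ + t₂ ^ 2)) ≤ 1 * R ^ 3 := val_mul_le w ha₆ (by
          refine w.map_add_le (w.map_add_le ?_ ?_) ?_
          · rw [map_pow]
            exact (pow_le_of_le_one zero_le ht₁le1 two_ne_zero).trans ht₁
          · calc w (t₁ * t₂) ≤ 1 * R ^ 3 := val_mul_le w ht₁le1 ht₂
              _ = R ^ 3 := one_mul _
          · rw [map_pow]
            exact (pow_le_of_le_one zero_le ht₂le1 two_ne_zero).trans ht₂)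
      _ = R ^ 3 := one_mul _
      _ ≤ R := hR3R

/-- **Slope data, chord case.** For two points `P₁ ≠ ±P₂` of the kernel of reduction with
`x₁ ≠ x₂`: the `Y`-intercept `c = y₁ - ℓ x₁` of the chord is non-zero, the chord passes
through `P₂`, and its slope in the `(z, w)`-chart is `λ = -ℓ/c = A/B` (Silverman, *AEC* IV.1,
p. 117: `λ = (w₂ - w₁)/(z₂ - z₁) = Σ A_{n-3} (z₁ⁿ - z₂ⁿ)/(z₁ - z₂)`, made finite by the tree's
`zw_chord`). [cite: SilvermanAEC2009, IV.1] -/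
theorem slope_data_of_X_ne {x₁ y₁ x₂ y₂ : F} (h₁ : V.toAffine.Equation x₁ y₁)
    (h₂ : V.toAffine.Equation x₂ y₂) (hx₁ : 1 < w x₁) (hx₂ : 1 < w x₂) (hx : x₁ ≠ x₂) :
    y₁ - V.toAffine.slope x₁ x₂ y₁ y₂ * x₁ ≠ 0 ∧
    V.toAffine.slope x₁ x₂ y₁ y₂ * x₂ + (y₁ - V.toAffine.slope x₁ x₂ y₁ y₂ * x₁) = y₂ ∧
    -V.toAffine.slope x₁ x₂ y₁ y₂ / (y₁ - V.toAffine.slope x₁ x₂ y₁ y₂ * x₁) =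
      ((-x₁ / y₁) ^ 2 + (-x₁ / y₁) * (-x₂ / y₂) + (-x₂ / y₂) ^ 2 + V.a₁ * (-1 / y₁)
          + V.a₂ * ((-x₁ / y₁) + (-x₂ / y₂)) * (-1 / y₁) + V.a₄ * (-1 / y₁) ^ 2) /
        (1 - V.a₁ * (-x₂ / y₂) - V.a₂ * (-x₂ / y₂) ^ 2 - V.a₃ * ((-1 / y₁) + (-1 / y₂))
          - V.a₄ * (-x₂ / y₂) * ((-1 / y₁) + (-1 / y₂))
          - V.a₆ * ((-1 / y₁) ^ 2 + (-1 / y₁) * (-1 / y₂) + (-1 / y₂) ^ 2)) := by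
  obtain ⟨hy₁0, hz₁lt, -, -, hw₁, -⟩ := val_zw h₁ hx₁
  obtain ⟨hy₂0, hz₂lt, -, -, hw₂, -⟩ := val_zw h₂ hx₂
  have hℓ : V.toAffine.slope x₁ x₂ y₁ y₂ = (y₁ - y₂) / (x₁ - x₂) :=
    WeierstrassCurve.Affine.slope_of_X_ne hx
  set ℓ := V.toAffine.slope x₁ x₂ y₁ y₂ with hℓdef
  have hx' : x₁ - x₂ ≠ 0 := sub_ne_zero.mpr hx
  have hy₂ℓ : ℓ * x₂ + (y₁ - ℓ * x₁) = y₂ := by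
    rw [hℓ]; field_simp; ring
  -- the chord in the chart
  have hzw₁ := WeierstrassCurve.Affine.equation_zw V.toAffine h₁ hy₁0
  have hzw₂ := WeierstrassCurve.Affine.equation_zw V.toAffine h₂ hy₂0
  have hAB := WeierstrassCurve.Affine.zw_chord hzw₁ hzw₂
  set z₁ := -x₁ / y₁ with hz₁
  set t₁ := -1 / y₁ with ht₁
  set z₂ := -x₂ / y₂ with hz₂
  set t₂ := -1 / y₂ with ht₂
  set R := max (w z₁) (w z₂) with hR
  have hRle : R ≤ 1 := (max_lt hz₁lt hz₂lt).le
  have ht₁R : w t₁ ≤ R ^ 3 := by rw [hw₁]; exact pow_le_pow_left₀ zero_le (le_max_left _ _) 3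
  have ht₂R : w t₂ ≤ R ^ 3 := by rw [hw₂]; exact pow_le_pow_left₀ zero_le (le_max_right _ _) 3
  set A := z₁ ^ 2 + z₁ * z₂ + z₂ ^ 2 + V.a₁ * t₁ + V.a₂ * (z₁ + z₂) * t₁ + V.a₄ * t₁ ^ 2 with hA
  set B := 1 - V.a₁ * z₂ - V.a₂ * z₂ ^ 2 - V.a₃ * (t₁ + t₂) - V.a₄ * z₂ * (t₁ + t₂)
    - V.a₆ * (t₁ ^ 2 + t₁ * t₂ + t₂ ^ 2) with hB
  have hBw : w B = 1 :=
    val_eq_one_of_val_sub_one_lt w (lt_of_le_of_lt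
      (val_B_sub_one_le (V := V) hRle (le_max_right _ _) ht₁R ht₂R) (max_lt hz₁lt hz₂lt))
  have hB0 : B ≠ 0 := fun h ↦ by rw [h, map_zero] at hBw; exact zero_ne_one hBw
  -- `c ≠ 0`
  have hcmul := WeierstrassCurve.Affine.chord_intercept_mul (A := A) (B := B) hy₁0 hy₂0 hx hAB
  rw [← hℓ] at hcmul
  have hc0 : y₁ - ℓ * x₁ ≠ 0 := by
    intro h0
    rw [h0, zero_mul] at hcmul
    exact hB0 (neg_eq_zero.mp hcmul.symm)
  refine ⟨hc0, hy₂ℓ, ?_⟩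
  -- `λ = A / B`
  set c := y₁ - ℓ * x₁ with hc
  have hy₁ℓ : ℓ * x₁ + c = y₁ := by rw [hc]; ring
  have hline₁ : -ℓ / c * z₁ + -1 / c = t₁ := by
    rw [hz₁, ht₁]; field_simp; linear_combination hy₁ℓ
  have hline₂ : -ℓ / c * z₂ + -1 / c = t₂ := by
    rw [hz₂, ht₂]; field_simp; linear_combination hy₂ℓ
  have hz12 : z₁ - z₂ ≠ 0 := by
    intro h0
    have ht : (t₁ - t₂) * B = 0 := by rw [hAB, h0, zero_mul]
    have ht' : t₁ = t₂ := sub_eq_zero.mp ((mul_eq_zero.mp ht).resolve_right hB0)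
    have hyy : y₁ = y₂ := by
      rw [ht₁, ht₂] at ht'
      have h' := (div_eq_div_iff hy₁0 hy₂0).mp ht'
      linear_combination h'
    apply hx
    have hzz : z₁ = z₂ := sub_eq_zero.mp h0
    rw [hz₁, hz₂, hyy] at hzz
    exact neg_inj.mp ((div_left_inj' hy₂0).mp hzz)
  rw [eq_div_iff hB0]
  apply mul_left_cancel₀ hz12
  linear_combination hAB + B * hline₁ - B * hline₂

/-- **Slope data, tangent case.** For a point `P = (x, y)` of the kernel of reduction with
`P ≠ -P`: the `Y`-intercept `c = y - ℓ x` of the tangent is non-zero and its slope in the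
`(z, w)`-chart is `λ = -ℓ/c = A/B` with `A = 3z² + a₁w + 2a₂zw + a₄w²`,
`B = 1 - a₁z - a₂z² - 2a₃w - 2a₄zw - 3a₆w²` (the partial derivatives of the chart equation:
`A y² = 3x² + 2a₂x + a₄ - a₁y`, `B y² = y² + a₁xy + 2a₃y - a₂x² - 2a₄x - 3a₆`).
[cite: SilvermanAEC2009, IV.1] -/
theorem slope_data_of_X_eq {x y : F} (h : V.toAffine.Equation x y) (hx : 1 < w x)
    (hy : y ≠ V.toAffine.negY x y) :
    y - V.toAffine.slope x x y y * x ≠ 0 ∧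
    V.toAffine.slope x x y y * x + (y - V.toAffine.slope x x y y * x) = y ∧
    -V.toAffine.slope x x y y / (y - V.toAffine.slope x x y y * x) =
      ((-x / y) ^ 2 + (-x / y) * (-x / y) + (-x / y) ^ 2 + V.a₁ * (-1 / y)
          + V.a₂ * ((-x / y) + (-x / y)) * (-1 / y) + V.a₄ * (-1 / y) ^ 2) /
        (1 - V.a₁ * (-x / y) - V.a₂ * (-x / y) ^ 2 - V.a₃ * ((-1 / y) + (-1 / y))
          - V.a₄ * (-x / y) * ((-1 / y) + (-1 / y))
          - V.a₆ * ((-1 / y) ^ 2 + (-1 / y) * (-1 / y) + (-1 / y) ^ 2)) := by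
  obtain ⟨hy0, hzlt, -, -, -, -⟩ := val_zw h hx
  obtain ⟨hxy, -⟩ := val_x_lt_val_y h hx
  have hy1 : 1 < w y := hx.trans hxy
  have ha₁ : w V.a₁ ≤ 1 := val_a₁_le_one
  have ha₂ : w V.a₂ ≤ 1 := val_a₂_le_one
  have ha₃ : w V.a₃ ≤ 1 := val_a₃_le_one
  have ha₄ : w V.a₄ ≤ 1 := val_a₄_le_one
  have ha₆ : w V.a₆ ≤ 1 := val_a₆_le_one
  have h2 : w (2 : F) ≤ 1 := by exact_mod_cast val_natCast_le_one w 2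
  have h3 : w (3 : F) ≤ 1 := by exact_mod_cast val_natCast_le_one w 3
  have hD : y - V.toAffine.negY x y ≠ 0 := sub_ne_zero.mpr hy
  have hℓ : V.toAffine.slope x x y y =
      (3 * x ^ 2 + 2 * V.toAffine.a₂ * x + V.toAffine.a₄ - V.toAffine.a₁ * y)
        / (y - V.toAffine.negY x y) :=
    WeierstrassCurve.Affine.slope_of_Y_ne rfl hy
  have hcD := WeierstrassCurve.Affine.Y_sub_slope_mul_X_mul V.toAffine h hy
  set ℓ := V.toAffine.slope x x y y with hℓdef
  -- `E = y² + a₁xy + 2a₃y - a₂x² - 2a₄x - 3a₆` has `|E| = |y|²`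
  have hwE : w (y ^ 2 + V.a₁ * x * y + 2 * V.a₃ * y - V.a₂ * x ^ 2 - 2 * V.a₄ * x - 3 * V.a₆)
      = w y ^ 2 := by
    have : y ^ 2 + V.a₁ * x * y + 2 * V.a₃ * y - V.a₂ * x ^ 2 - 2 * V.a₄ * x - 3 * V.a₆
        = y ^ 2 + (V.a₁ * x * y + 2 * V.a₃ * y - V.a₂ * x ^ 2 - 2 * V.a₄ * x - 3 * V.a₆) := by
      ring
    rw [this, w.map_add_eq_of_lt_left, map_pow]
    rw [map_pow]
    have hy2 : w y < w y ^ 2 := lt_self_pow₀ hy1 one_lt_two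
    have hxlt : w x < w y ^ 2 := hxy.trans hy2
    refine w.map_sub_lt (w.map_sub_lt (w.map_sub_lt (w.map_add_lt ?_ ?_) ?_) ?_) ?_
    · calc w (V.a₁ * x * y) ≤ 1 * w x * w y := val_mul₃_le w ha₁ le_rfl le_rfl
        _ = w x * w y := by rw [one_mul]
        _ < w y * w y := by gcongr
        _ = w y ^ 2 := (sq _).symm
    · calc w (2 * V.a₃ * y) ≤ 1 * 1 * w y := val_mul₃_le w h2 ha₃ le_rfl
        _ = w y := by ring
        _ < w y ^ 2 := hy2
    · calc w (V.a₂ * x ^ 2) ≤ 1 * w x ^ 2 := val_mul_le w ha₂ (by rw [map_pow])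
        _ = w x ^ 2 := one_mul _
        _ < w y ^ 2 := pow_lt_pow_left₀ hxy zero_le two_ne_zero
    · calc w (2 * V.a₄ * x) ≤ 1 * 1 * w x := val_mul₃_le w h2 ha₄ le_rfl
        _ = w x := by ring
        _ < w y ^ 2 := hxlt
    · calc w (3 * V.a₆) ≤ 1 * 1 := val_mul_le w h3 ha₆
        _ = 1 := one_mul _
        _ < w y ^ 2 := one_lt_pow₀ hy1 two_ne_zero
  have hE0 : y ^ 2 + V.a₁ * x * y + 2 * V.a₃ * y - V.a₂ * x ^ 2 - 2 * V.a₄ * x - 3 * V.a₆ ≠ 0 := by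
    intro h0
    rw [h0, map_zero] at hwE
    exact pow_ne_zero 2 (zero_lt_one.trans hy1).ne' hwE.symm
  have hc0 : y - ℓ * x ≠ 0 := by
    intro h0
    rw [h0, zero_mul] at hcD
    exact hE0 (neg_eq_zero.mp hcD.symm)
  refine ⟨hc0, by ring, ?_⟩
  set c := y - ℓ * x with hc
  have hA : (-x / y) ^ 2 + (-x / y) * (-x / y) + (-x / y) ^ 2 + V.a₁ * (-1 / y)
      + V.a₂ * ((-x / y) + (-x / y)) * (-1 / y) + V.a₄ * (-1 / y) ^ 2
      = (3 * x ^ 2 + 2 * V.a₂ * x + V.a₄ - V.a₁ * y) / y ^ 2 := by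
    field_simp
    ring
  have hB : 1 - V.a₁ * (-x / y) - V.a₂ * (-x / y) ^ 2 - V.a₃ * ((-1 / y) + (-1 / y))
      - V.a₄ * (-x / y) * ((-1 / y) + (-1 / y))
      - V.a₆ * ((-1 / y) ^ 2 + (-1 / y) * (-1 / y) + (-1 / y) ^ 2)
      = (y ^ 2 + V.a₁ * x * y + 2 * V.a₃ * y - V.a₂ * x ^ 2 - 2 * V.a₄ * x - 3 * V.a₆) / y ^ 2 := by
    field_simp
    ring
  have hcD' : c * (y - V.toAffine.negY x y) =
      -(y ^ 2 + V.a₁ * x * y + 2 * V.a₃ * y - V.a₂ * x ^ 2 - 2 * V.a₄ * x - 3 * V.a₆) := hcD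
  rw [hA, hB, div_div_div_cancel_right₀ (pow_ne_zero 2 hy0), hℓ, ← neg_div, div_div,
    div_eq_div_iff (mul_ne_zero hD hc0) hE0]
  linear_combination (-(3 * x ^ 2 + 2 * V.a₂ * x + V.a₄ - V.a₁ * y)) * hcD'

end SlopeData

end FormalGroupChart

end Literature.NumberTheory.EllipticCurves

namespace Literature.NumberTheory.EllipticCurves

namespace FormalGroupChart

section Coordinates

variable {F : Type*} [Field F] {w : Valuation F ℝ≥0} {V : WeierstrassCurve F}
  [hV : V.IsIntegral w.integer]

/-- **The chord–tangent law in the chart at `O`** (coordinates): for two affine points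
`P₁ = (x₁, y₁)`, `P₂ = (x₂, y₂)` of the kernel of reduction with `P₁ + P₂ ≠ O`, the sum
`P₁ + P₂ = (x₃, y₃)` lies in the kernel of reduction, and `zᵢ = -xᵢ/yᵢ` satisfy
`|z₃ - z₁ - z₂| ≤ max(|z₁|, |z₂|)²` and `|z₃ - z₁| = |z₂|` (Silverman, *AEC* IV.1 and VII.2.2:
`z₃ = F(z₁, z₂) = z₁ + z₂ + (terms of degree ≥ 2, all divisible by z₁ z₂)`).
[cite: SilvermanAEC2009, IV.1 and Prop. VII.2.2] -/
theorem val_add {x₁ y₁ x₂ y₂ : F} (h₁ : V.toAffine.Equation x₁ y₁)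
    (h₂ : V.toAffine.Equation x₂ y₂) (hx₁ : 1 < w x₁) (hx₂ : 1 < w x₂)
    (hxy : ¬(x₁ = x₂ ∧ y₁ = V.toAffine.negY x₂ y₂)) :
    1 < w (V.toAffine.addX x₁ x₂ (V.toAffine.slope x₁ x₂ y₁ y₂)) ∧
    w (-V.toAffine.addX x₁ x₂ (V.toAffine.slope x₁ x₂ y₁ y₂) /
          V.toAffine.addY x₁ x₂ y₁ (V.toAffine.slope x₁ x₂ y₁ y₂) - -x₁ / y₁ - -x₂ / y₂) ≤
      max (w (-x₁ / y₁)) (w (-x₂ / y₂)) ^ 2 ∧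
    w (-V.toAffine.addX x₁ x₂ (V.toAffine.slope x₁ x₂ y₁ y₂) /
          V.toAffine.addY x₁ x₂ y₁ (V.toAffine.slope x₁ x₂ y₁ y₂) - -x₁ / y₁) = w (-x₂ / y₂) := by
  by_cases hx : x₁ = x₂
  · have hy : y₁ ≠ V.toAffine.negY x₂ y₂ := fun h ↦ hxy ⟨hx, h⟩
    subst hx
    have hyy : y₁ = y₂ := WeierstrassCurve.Affine.Y_eq_of_Y_ne h₁ h₂ rfl hy
    subst hyy
    obtain ⟨hc0, hyℓ, hlam⟩ := slope_data_of_X_eq h₁ hx₁ hy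
    exact chain h₁ h₁ hx₁ hx₁ hxy hc0 hyℓ hlam
  · obtain ⟨hc0, hy₂ℓ, hlam⟩ := slope_data_of_X_ne h₁ h₂ hx₁ hx₂ hx
    exact chain h₁ h₂ hx₁ hx₂ hxy hc0 hy₂ℓ hlam

/-- **Negation in the chart**: for `P = (x, y)` in the kernel of reduction,
`-P = (x, -y - a₁x - a₃)` has `z(-P) = -z/(1 - a₁z - a₃w)` (Silverman, *AEC* IV.1, the
series `i(z)`), so `|z(-P)| = |z(P)|` and `|z(P) + z(-P)| ≤ |z(P)|²`.
[cite: SilvermanAEC2009, IV.1] -/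
theorem val_neg {x y : F} (h : V.toAffine.Equation x y) (hx : 1 < w x) :
    V.toAffine.negY x y ≠ 0 ∧ w (-x / V.toAffine.negY x y) = w (-x / y) ∧
      w (-x / y + -x / V.toAffine.negY x y) ≤ w (-x / y) ^ 2 := by
  obtain ⟨hy0, hzlt, -, -, hw, -⟩ := val_zw h hx
  have ha₁ : w V.a₁ ≤ 1 := val_a₁_le_one
  have ha₃ : w V.a₃ ≤ 1 := val_a₃_le_one
  set z := -x / y with hz
  set t := -1 / y with ht
  set u := 1 - V.a₁ * z - V.a₃ * t with hu
  have htr : w t ≤ w z := by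
    rw [hw]; exact pow_le_of_le_one zero_le hzlt.le three_ne_zero
  have hu1 : w (u - 1) ≤ w z := by
    have : u - 1 = -(V.a₁ * z + V.a₃ * t) := by rw [hu]; ring
    rw [this, Valuation.map_neg]
    refine w.map_add_le ?_ ?_
    · simpa only [one_mul] using val_mul_le w ha₁ (le_refl (w z))
    · simpa only [one_mul] using val_mul_le w ha₃ htr
  have huw : w u = 1 := val_eq_one_of_val_sub_one_lt w (lt_of_le_of_lt hu1 hzlt)
  have hu0 : u ≠ 0 := fun h0 ↦ by rw [h0, map_zero] at huw; exact zero_ne_one huw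
  have hneg : V.toAffine.negY x y = -y * u := by
    simp only [WeierstrassCurve.Affine.negY]
    rw [hu, hz, ht]
    field_simp
    ring
  have hneg0 : V.toAffine.negY x y ≠ 0 := by
    rw [hneg]; exact mul_ne_zero (neg_ne_zero.mpr hy0) hu0
  have hzneg : -x / V.toAffine.negY x y = -z / u := by
    rw [hneg, hz]; field_simp
  refine ⟨hneg0, ?_, ?_⟩
  · rw [hzneg, map_div₀, Valuation.map_neg, huw, div_one]
  · have : z + -z / u = z * (u - 1) / u := by field_simp; ring
    rw [hzneg, this, map_div₀, huw, div_one, sq]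
    exact val_mul_le w le_rfl hu1

/-- **`z` is injective on the kernel of reduction** (coordinates): two affine points of the
kernel of reduction with the same parameter `z = -x/y` are equal. (With `x = -zy` the
equation becomes `z³y³ + (1 - a₁z - a₂z²)y² + (a₃ + a₄z)y - a₆ = 0`; two distinct roots
`y, y'` of size `|z|⁻³` would force, by Vieta, `|yy' + y''(y + y')| = |z|⁻⁶ > |z|⁻³`.)
[cite: SilvermanAEC2009, Prop. VII.2.2] -/
theorem eq_of_z_eq {x y x' y' : F} (h : V.toAffine.Equation x y) (h' : V.toAffine.Equation x' y')
    (hx : 1 < w x) (hx' : 1 < w x') (hz : -x / y = -x' / y') : x = x' ∧ y = y' := by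
  obtain ⟨hy0, hzlt, -, hyz, -, hzpos⟩ := val_zw h hx
  obtain ⟨hy0', -, -, hyz', -, -⟩ := val_zw h' hx'
  rw [← hz] at hyz'
  have ha₆ : w V.a₆ ≤ 1 := val_a₆_le_one
  have ha₃ : w V.a₃ ≤ 1 := val_a₃_le_one
  have ha₄ : w V.a₄ ≤ 1 := val_a₄_le_one
  set z₀ := -x / y with hz₀
  have hxz : x = -z₀ * y := by rw [hz₀]; field_simp
  have hxz' : x' = -z₀ * y' := by rw [hz]; field_simp
  suffices hyy : y = y' by
    refine ⟨?_, hyy⟩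
    rw [hxz, hxz', hyy]
  by_contra hne
  set u := 1 - V.a₁ * z₀ - V.a₂ * z₀ ^ 2 with hu
  set t := V.a₃ + V.a₄ * z₀ with ht
  clear_value u t z₀
  have hg : z₀ ^ 3 * y ^ 3 + u * y ^ 2 + t * y - V.a₆ = 0 := by
    rw [WeierstrassCurve.Affine.equation_iff, hxz] at h
    rw [hu, ht]; linear_combination h
  have hg' : z₀ ^ 3 * y' ^ 3 + u * y' ^ 2 + t * y' - V.a₆ = 0 := by
    rw [WeierstrassCurve.Affine.equation_iff, hxz'] at h'
    rw [hu, ht]; linear_combination h'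
  have hS : z₀ ^ 3 * (y ^ 2 + y * y' + y' ^ 2) + u * (y + y') + t = 0 := by
    have : (y - y') * (z₀ ^ 3 * (y ^ 2 + y * y' + y' ^ 2) + u * (y + y') + t) = 0 := by
      linear_combination hg - hg'
    exact (mul_eq_zero.mp this).resolve_left (sub_ne_zero.mpr hne)
  have he₃ : y * y' * (-u - z₀ ^ 3 * y - z₀ ^ 3 * y') = V.a₆ := by
    linear_combination hg - y * hS
  have he₂ : z₀ ^ 3 * (y * y') + (-u - z₀ ^ 3 * y - z₀ ^ 3 * y') * (y + y') = t := by
    linear_combination -hS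
  -- sizes: `|y| = |y'| = Y`, `Y |z₀|³ = 1`, `Y > 1`
  set Y := w y with hY
  have hY' : w y' = Y := by
    have h3 : (0 : ℝ≥0) < w z₀ ^ 3 := pow_pos hzpos 3
    apply mul_right_cancel₀ h3.ne'
    rw [hyz', hyz]
  obtain ⟨hxy, -⟩ := val_x_lt_val_y h hx
  have hY1 : 1 < Y := hx.trans hxy
  have hY0 : Y ≠ 0 := (zero_lt_one.trans hY1).ne'
  -- `|y''| ≤ Y⁻²` in the form `|y''| Y² ≤ 1`
  have h3le : w (-u - z₀ ^ 3 * y - z₀ ^ 3 * y') * (Y * Y) ≤ 1 := by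
    have := congrArg w he₃
    rw [map_mul, map_mul, hY'] at this
    calc w (-u - z₀ ^ 3 * y - z₀ ^ 3 * y') * (Y * Y)
        = Y * Y * w (-u - z₀ ^ 3 * y - z₀ ^ 3 * y') := by ring
      _ = w V.a₆ := this
      _ ≤ 1 := ha₆
  have h3lt : w (-u - z₀ ^ 3 * y - z₀ ^ 3 * y') < 1 := by
    by_contra hge
    rw [not_lt] at hge
    have hYY : (1 : ℝ≥0) < Y * Y := by
      calc (1 : ℝ≥0) = 1 * 1 := (one_mul 1).symm
        _ < Y * Y := mul_lt_mul'' hY1 hY1 zero_le zero_le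
    have : Y * Y ≤ 1 :=
      calc Y * Y = 1 * (Y * Y) := (one_mul _).symm
        _ ≤ w (-u - z₀ ^ 3 * y - z₀ ^ 3 * y') * (Y * Y) := by gcongr
        _ ≤ 1 := h3le
    exact absurd this (not_le.mpr hYY)
  -- the dominant term of `e₂` is `z₀³ y y'`, of size `Y`
  have hmain : w (z₀ ^ 3 * (y * y')) = Y := by
    rw [map_mul, map_mul, map_pow, hY']
    calc w z₀ ^ 3 * (Y * Y) = (Y * w z₀ ^ 3) * Y := by ring
      _ = Y := by rw [hyz, one_mul]
  have hrest : w ((-u - z₀ ^ 3 * y - z₀ ^ 3 * y') * (y + y')) < Y := by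
    rw [map_mul]
    calc w (-u - z₀ ^ 3 * y - z₀ ^ 3 * y') * w (y + y')
        ≤ w (-u - z₀ ^ 3 * y - z₀ ^ 3 * y') * Y :=
          mul_le_mul' le_rfl (w.map_add_le le_rfl hY'.le)
      _ < 1 * Y := by gcongr
      _ = Y := one_mul _
  have hwt : w t ≤ 1 := by
    rw [ht]
    refine w.map_add_le ha₃ ?_
    calc w (V.a₄ * z₀) ≤ 1 * 1 := val_mul_le w ha₄ hzlt.le
      _ = 1 := one_mul _
  have := congrArg w he₂
  rw [w.map_add_eq_of_lt_left (by rwa [hmain]), hmain] at this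
  rw [this] at hY1
  exact absurd hwt (not_le.mpr hY1)

end Coordinates

end FormalGroupChart

end Literature.NumberTheory.EllipticCurves

/-! ### The parameter `z = -x/y` of a point and the kernel of reduction as a group -/

namespace WeierstrassCurve.Affine.Point

variable {F : Type*} [Field F] {W : WeierstrassCurve.Affine F}

/-- The **local parameter at `O`** of a point of a Weierstrass curve over a field: `z(O) = 0`,
`z(x, y) = -x/y` (junk value `0` when `y = 0`; on the kernel of reduction `y ≠ 0`). A deliberate
dot-notation extension of Mathlib's `WeierstrassCurve.Affine.Point` (nothing of this name exists
in Mathlib; the tree's `WeierstrassCurve.formalParameter` is the special case `F = ℚ_p`). Silverman, *AEC* IV.1 ("`z = -x/y`") and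
Prop. VII.2.2 (the map `E₁(K) → Ê(𝓜)`, `(x, y) ↦ -x/y`). [cite: SilvermanAEC2009, Prop. VII.2.2] -/
def zCoord : W.Point → F
  | 0 => 0
  | .some x y _ => -x / y

/-- `z(O) = 0`. [folklore] -/
@[simp] theorem zCoord_zero : zCoord (0 : W.Point) = 0 := rfl

/-- `z(O) = 0` (constructor form). [folklore] -/
@[simp] theorem zCoord_zero' : zCoord (.zero : W.Point) = 0 := rfl

/-- `z(x, y) = -x/y`. [folklore] -/
@[simp] theorem zCoord_some {x y : F} (h : W.Nonsingular x y) : zCoord (.some x y h) = -x / y := rfl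

end WeierstrassCurve.Affine.Point

namespace Literature.NumberTheory.EllipticCurves

namespace FormalGroupChart

section Points

variable {F : Type*} [Field F] (w : Valuation F ℝ≥0) (V : WeierstrassCurve F)

/-- **The kernel of reduction `E₁` as a subgroup** of the group of points of a `w`-integral
Weierstrass equation over a valued field `(F, w)`: `O` together with the affine points
`(x, y)` with `|x| > 1` (Silverman, *AEC* VII.2, Prop. VII.2.1/VII.2.2: `E₁(K)` is a subgroup;
closure under addition is the estimate `val_add`). The same set as the tree's
`WeierstrassCurve.kernelOfReduction` (file `ReductionHomomorphism`, phrased for `W.baseChange K`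
over a valuation ring) and as the complement of `Literature.IsIntegralPoint` plus `O`
(file `PointReduction`). [cite: SilvermanAEC2009, Prop. VII.2.2] -/
def kernel [hV : V.IsIntegral w.integer] : AddSubgroup V.toAffine.Point where
  carrier := {P | ∀ {x y : F} {h : V.toAffine.Nonsingular x y}, P = .some x y h → 1 < w x}
  zero_mem' := fun h ↦ (WeierstrassCurve.Affine.Point.some_ne_zero _ h.symm).elim
  add_mem' := by
    intro P Q hP hQ
    rcases P with _ | ⟨x₁, y₁, h₁⟩
    · intro x y h he
      rw [← WeierstrassCurve.Affine.Point.zero_def, zero_add] at he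
      exact hQ he
    rcases Q with _ | ⟨x₂, y₂, h₂⟩
    · intro x y h he
      rw [← WeierstrassCurve.Affine.Point.zero_def, add_zero] at he
      exact hP he
    intro x y h he
    by_cases hxy : x₁ = x₂ ∧ y₁ = V.toAffine.negY x₂ y₂
    · rw [WeierstrassCurve.Affine.Point.add_of_Y_eq hxy.1 hxy.2] at he
      exact (WeierstrassCurve.Affine.Point.some_ne_zero _ he.symm).elim
    · rw [WeierstrassCurve.Affine.Point.add_some hxy] at he
      simp only [WeierstrassCurve.Affine.Point.some.injEq] at he
      rw [← he.1]
      exact (val_add h₁.left h₂.left (hP rfl) (hQ rfl) hxy).1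
  neg_mem' := by
    intro P hP
    rcases P with _ | ⟨x₁, y₁, h₁⟩
    · intro x y h he
      rw [← WeierstrassCurve.Affine.Point.zero_def, neg_zero] at he
      exact hP he
    · intro x y h he
      rw [WeierstrassCurve.Affine.Point.neg_some] at he
      simp only [WeierstrassCurve.Affine.Point.some.injEq] at he
      rw [← he.1]
      exact hP rfl

variable {w V}
variable [hV : V.IsIntegral w.integer]

/-- Membership of an affine point in `E₁`: `|x| > 1`. [folklore] -/
theorem some_mem_kernel_iff {x y : F} (h : V.toAffine.Nonsingular x y) :
    (.some x y h : V.toAffine.Point) ∈ kernel w V ↔ 1 < w x := by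
  refine ⟨fun hP ↦ hP rfl, fun hx x' y' h' he ↦ ?_⟩
  simp only [WeierstrassCurve.Affine.Point.some.injEq] at he
  rw [← he.1]; exact hx

/-- Construct membership in `E₁` for an affine point. [folklore] -/
theorem some_mem_kernel {x y : F} (h : V.toAffine.Nonsingular x y) (hx : 1 < w x) :
    (.some x y h : V.toAffine.Point) ∈ kernel w V :=
  (some_mem_kernel_iff h).mpr hx

/-- **`|z(P)| < 1` on `E₁`.** [cite: SilvermanAEC2009, Prop. VII.2.2] -/
theorem val_zCoord_lt_one {P : V.toAffine.Point} (hP : P ∈ kernel w V) : w P.zCoord < 1 := by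
  rcases P with _ | ⟨x, y, h⟩
  · rw [WeierstrassCurve.Affine.Point.zCoord_zero', map_zero]; exact zero_lt_one
  · rw [WeierstrassCurve.Affine.Point.zCoord_some]
    exact (val_zw h.left (hP rfl)).2.1

/-- On `E₁`, `z(P) = 0` only for `P = O`. [folklore] -/
theorem zCoord_eq_zero_iff {P : V.toAffine.Point} (hP : P ∈ kernel w V) :
    P.zCoord = 0 ↔ P = 0 := by
  rcases P with _ | ⟨x, y, h⟩
  · exact ⟨fun _ ↦ rfl, fun _ ↦ rfl⟩
  · rw [WeierstrassCurve.Affine.Point.zCoord_some]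
    refine ⟨fun h0 ↦ ?_, fun h0 ↦ (WeierstrassCurve.Affine.Point.some_ne_zero _ h0).elim⟩
    have hpos := (val_zw h.left (hP rfl)).2.2.2.2.2
    rw [h0, map_zero] at hpos
    exact (lt_irrefl _ hpos).elim

/-- For an affine point `(x, y) ∈ E₁`: `|x| · |z|² = 1`, `|y| · |z|³ = 1` and `y ≠ 0`
(`x = z/w`, `y = -1/w`, `|w| = |z|³`). [cite: SilvermanAEC2009, Prop. VII.2.2] -/
theorem val_X_mul_val_zCoord_sq {x y : F} {h : V.toAffine.Nonsingular x y}
    (hP : (.some x y h : V.toAffine.Point) ∈ kernel w V) :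
    w x * w (-x / y) ^ 2 = 1 ∧ w y * w (-x / y) ^ 3 = 1 ∧ y ≠ 0 :=
  let hh := val_zw h.left (hP rfl)
  ⟨hh.2.2.1, hh.2.2.2.1, hh.1⟩

/-- **`|z(-P)| = |z(P)|` on `E₁`.** [cite: SilvermanAEC2009, IV.1] -/
theorem val_zCoord_neg {P : V.toAffine.Point} (hP : P ∈ kernel w V) :
    w (-P).zCoord = w P.zCoord := by
  rcases P with _ | ⟨x, y, h⟩
  · rfl
  · rw [WeierstrassCurve.Affine.Point.neg_some, WeierstrassCurve.Affine.Point.zCoord_some,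
      WeierstrassCurve.Affine.Point.zCoord_some]
    exact (val_neg h.left (hP rfl)).2.1

/-- **First-order additivity of `z` on `E₁`**: `|z(P + Q) - z(P) - z(Q)| ≤ max(|z(P)|, |z(Q)|)²`
(Silverman, *AEC* IV.1: `F(z₁, z₂) = z₁ + z₂ + (deg ≥ 2)`; Prop. VII.2.2: `z(P + Q) =
F(z(P), z(Q))`). [cite: SilvermanAEC2009, IV.1 and Prop. VII.2.2] -/
theorem val_zCoord_add_sub_le {P Q : V.toAffine.Point} (hP : P ∈ kernel w V)
    (hQ : Q ∈ kernel w V) :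
    w ((P + Q).zCoord - P.zCoord - Q.zCoord) ≤ max (w P.zCoord) (w Q.zCoord) ^ 2 := by
  rcases P with _ | ⟨x₁, y₁, h₁⟩
  · rw [← WeierstrassCurve.Affine.Point.zero_def, zero_add, WeierstrassCurve.Affine.Point.zCoord_zero,
      sub_zero, sub_self, map_zero]
    exact zero_le
  rcases Q with _ | ⟨x₂, y₂, h₂⟩
  · rw [← WeierstrassCurve.Affine.Point.zero_def, add_zero, WeierstrassCurve.Affine.Point.zCoord_zero,
      sub_zero, sub_self, map_zero]
    exact zero_le
  by_cases hxy : x₁ = x₂ ∧ y₁ = V.toAffine.negY x₂ y₂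
  · -- `Q = -P`
    obtain ⟨hx, hy⟩ := hxy
    rw [WeierstrassCurve.Affine.Point.add_of_Y_eq hx hy, WeierstrassCurve.Affine.Point.zCoord_zero,
      WeierstrassCurve.Affine.Point.zCoord_some, WeierstrassCurve.Affine.Point.zCoord_some, zero_sub,
      ← neg_add', Valuation.map_neg, hx, hy]
    obtain ⟨-, h2, h3⟩ := val_neg (w := w) h₂.left (hQ rfl)
    rw [h2, max_self, add_comm]
    exact h3
  · rw [WeierstrassCurve.Affine.Point.add_some hxy, WeierstrassCurve.Affine.Point.zCoord_some,
      WeierstrassCurve.Affine.Point.zCoord_some, WeierstrassCurve.Affine.Point.zCoord_some]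
    exact (val_add h₁.left h₂.left (hP rfl) (hQ rfl) hxy).2.1

/-- **Translations of `E₁` are isometries for `z`**: `|z(P + Q) - z(P)| = |z(Q)|`
(Silverman, *AEC* IV.1: `F(z₁, z₂) - z₁ = z₂ · (unit)`; Prop. VII.2.2).
[cite: SilvermanAEC2009, IV.1 and Prop. VII.2.2] -/
theorem val_zCoord_add_sub_eq {P Q : V.toAffine.Point} (hP : P ∈ kernel w V)
    (hQ : Q ∈ kernel w V) :
    w ((P + Q).zCoord - P.zCoord) = w Q.zCoord := by
  rcases P with _ | ⟨x₁, y₁, h₁⟩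
  · rw [← WeierstrassCurve.Affine.Point.zero_def, zero_add, WeierstrassCurve.Affine.Point.zCoord_zero,
      sub_zero]
  rcases Q with _ | ⟨x₂, y₂, h₂⟩
  · rw [← WeierstrassCurve.Affine.Point.zero_def, add_zero, WeierstrassCurve.Affine.Point.zCoord_zero,
      sub_self]
  by_cases hxy : x₁ = x₂ ∧ y₁ = V.toAffine.negY x₂ y₂
  · obtain ⟨hx, hy⟩ := hxy
    rw [WeierstrassCurve.Affine.Point.add_of_Y_eq hx hy, WeierstrassCurve.Affine.Point.zCoord_zero,
      WeierstrassCurve.Affine.Point.zCoord_some, WeierstrassCurve.Affine.Point.zCoord_some, zero_sub,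
      Valuation.map_neg, hx, hy]
    obtain ⟨-, h2, -⟩ := val_neg (w := w) h₂.left (hQ rfl)
    exact h2
  · rw [WeierstrassCurve.Affine.Point.add_some hxy, WeierstrassCurve.Affine.Point.zCoord_some,
      WeierstrassCurve.Affine.Point.zCoord_some, WeierstrassCurve.Affine.Point.zCoord_some]
    exact (val_add h₁.left h₂.left (hP rfl) (hQ rfl) hxy).2.2

/-- **The level sets of `z` are subgroups**: `|z(P + Q)| ≤ max(|z(P)|, |z(Q)|)` on `E₁`
(Silverman, *AEC* IV.3: the filtration `Ê(𝓜ⁿ)`). [cite: SilvermanAEC2009, Prop. VII.2.2] -/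
theorem val_zCoord_add_le {P Q : V.toAffine.Point} (hP : P ∈ kernel w V) (hQ : Q ∈ kernel w V) :
    w (P + Q).zCoord ≤ max (w P.zCoord) (w Q.zCoord) := by
  have h := val_zCoord_add_sub_le hP hQ
  have hmax1 : max (w P.zCoord) (w Q.zCoord) ≤ 1 :=
    max_le (val_zCoord_lt_one hP).le (val_zCoord_lt_one hQ).le
  have h' : w ((P + Q).zCoord - P.zCoord - Q.zCoord) ≤ max (w P.zCoord) (w Q.zCoord) :=
    h.trans (pow_le_of_le_one zero_le hmax1 two_ne_zero)
  have : (P + Q).zCoord = ((P + Q).zCoord - P.zCoord - Q.zCoord) + P.zCoord + Q.zCoord := by ring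
  rw [this]
  exact w.map_add_le (w.map_add_le h' (le_max_left _ _)) (le_max_right _ _)

/-- **`z` is injective on `E₁`** (Silverman, *AEC* Prop. VII.2.2: `z` gives a bijection
`E₁(K) → Ê(𝓜)` for complete `K`; injectivity needs no completeness).
[cite: SilvermanAEC2009, Prop. VII.2.2] -/
theorem zCoord_injOn :
    Set.InjOn WeierstrassCurve.Affine.Point.zCoord (kernel w V : Set V.toAffine.Point) := by
  rintro (_ | ⟨x, y, h⟩) hP (_ | ⟨x', y', h'⟩) hQ hz
  · rfl
  · exact ((zCoord_eq_zero_iff hQ).mp hz.symm).symm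
  · exact (zCoord_eq_zero_iff hP).mp hz
  · rw [WeierstrassCurve.Affine.Point.zCoord_some, WeierstrassCurve.Affine.Point.zCoord_some] at hz
    obtain ⟨hx, hy⟩ := eq_of_z_eq h.left h'.left (hP rfl) (hQ rfl) hz
    subst hx hy
    rfl

/-- **`z` is an isometry of `E₁` onto its image**: `|z(P) - z(Q)| = |z(P - Q)|`. [folklore] -/
theorem val_zCoord_sub {P Q : V.toAffine.Point} (hP : P ∈ kernel w V) (hQ : Q ∈ kernel w V) :
    w (P.zCoord - Q.zCoord) = w (P - Q).zCoord := by
  have h := val_zCoord_add_sub_eq hQ ((kernel w V).sub_mem hP hQ)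
  rwa [add_sub_cancel] at h

end Points

/-! ### Points of `E₁` with prescribed parameter: the cubic in `y` and its monic form -/

section Roots

variable {F : Type*} [Field F] {w : Valuation F ℝ≥0} {V : WeierstrassCurve F}

/-- **The Weierstrass equation along `x = -z₀ y`** is the cubic
`z₀³y³ + (1 - a₁z₀ - a₂z₀²)y² + (a₃ + a₄z₀)y - a₆ = 0` in `y`: a root gives the point
`(-z₀y, y)`, of parameter `z₀` when `y ≠ 0` (Silverman, *AEC* IV.1: the curve in the
`(z, w)`-plane). [cite: SilvermanAEC2009, IV.1] -/
theorem equation_of_root {z₀ y : F}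
    (hg : z₀ ^ 3 * y ^ 3 + (1 - V.a₁ * z₀ - V.a₂ * z₀ ^ 2) * y ^ 2 + (V.a₃ + V.a₄ * z₀) * y
      - V.a₆ = 0) :
    V.toAffine.Equation (-z₀ * y) y := by
  rw [WeierstrassCurve.Affine.equation_iff]
  linear_combination hg

/-- Conversely every affine point with `y ≠ 0` and parameter `z₀ = -x/y` gives a root `y` of
that cubic. [cite: SilvermanAEC2009, IV.1] -/
theorem root_of_equation {x y : F} (h : V.toAffine.Equation x y) (hy : y ≠ 0) :
    (-x / y) ^ 3 * y ^ 3 + (1 - V.a₁ * (-x / y) - V.a₂ * (-x / y) ^ 2) * y ^ 2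
      + (V.a₃ + V.a₄ * (-x / y)) * y - V.a₆ = 0 := by
  rw [WeierstrassCurve.Affine.equation_iff] at h
  field_simp
  linear_combination h

/-- The **monic form**: `G(v) = v³ + u v² + t z₀³ v - a₆ z₀⁶` (`u = 1 - a₁z₀ - a₂z₀²`,
`t = a₃ + a₄z₀`) satisfies `G(y z₀³) = z₀⁶ · g(y)` for the cubic `g` of `equation_of_root`;
`G` is monic with integral coefficients and reduces to `V²(V + ū)`, the form to which
Hensel's lemma / root lifting applies. [folklore] -/
theorem monic_cubic_eval (z₀ y : F) :
    (y * z₀ ^ 3) ^ 3 + (1 - V.a₁ * z₀ - V.a₂ * z₀ ^ 2) * (y * z₀ ^ 3) ^ 2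
        + (V.a₃ + V.a₄ * z₀) * z₀ ^ 3 * (y * z₀ ^ 3) - V.a₆ * z₀ ^ 6 =
      z₀ ^ 6 * (z₀ ^ 3 * y ^ 3 + (1 - V.a₁ * z₀ - V.a₂ * z₀ ^ 2) * y ^ 2 + (V.a₃ + V.a₄ * z₀) * y
        - V.a₆) := by
  ring

variable [hV : V.IsIntegral w.integer]

/-- The size of the point attached to a root `y` with `|y| |z₀|³ = 1`: `|x| = |z₀|⁻² > 1`.
[folklore] -/
theorem one_lt_val_of_root {z₀ y : F} (hz₀ : 0 < w z₀) (hz₀1 : w z₀ < 1)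
    (hy : w y * w z₀ ^ 3 = 1) : 1 < w (-z₀ * y) := by
  rw [map_mul, Valuation.map_neg]
  have h3 : w z₀ * w y = (w z₀ ^ 2)⁻¹ := by
    apply eq_inv_of_mul_eq_one_left
    calc w z₀ * w y * w z₀ ^ 2 = w y * w z₀ ^ 3 := by ring
      _ = 1 := hy
  rw [h3, one_lt_inv₀ (pow_pos hz₀ 2)]
  exact pow_lt_one₀ zero_le hz₀1 two_ne_zero

/-- **Uniqueness of the large root**: two roots `y, y'` of the cubic of `equation_of_root` with
`|y| |z₀|³ = |y'| |z₀|³ = 1` coincide (they give two points of `E₁` with the same parameter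
`z₀`, `eq_of_z_eq`). This is what makes Hensel lifts, and hence points of `E₁` with prescribed
parameter, descend to fixed fields. [folklore] -/
theorem root_unique {z₀ y y' : F} (hz₀ : 0 < w z₀) (hz₀1 : w z₀ < 1)
    (hg : z₀ ^ 3 * y ^ 3 + (1 - V.a₁ * z₀ - V.a₂ * z₀ ^ 2) * y ^ 2 + (V.a₃ + V.a₄ * z₀) * y
      - V.a₆ = 0)
    (hg' : z₀ ^ 3 * y' ^ 3 + (1 - V.a₁ * z₀ - V.a₂ * z₀ ^ 2) * y' ^ 2 + (V.a₃ + V.a₄ * z₀) * y'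
      - V.a₆ = 0)
    (hy : w y * w z₀ ^ 3 = 1) (hy' : w y' * w z₀ ^ 3 = 1) : y = y' := by
  have hz0 : z₀ ≠ 0 := (Valuation.pos_iff _).mp hz₀
  have hy0 : y ≠ 0 := by
    intro h; rw [h, map_zero, zero_mul] at hy; exact zero_ne_one hy
  have hy0' : y' ≠ 0 := by
    intro h; rw [h, map_zero, zero_mul] at hy'; exact zero_ne_one hy'
  have hz : -(-z₀ * y) / y = -(-z₀ * y') / y' := by field_simp
  exact (eq_of_z_eq (equation_of_root hg) (equation_of_root hg') (one_lt_val_of_root hz₀ hz₀1 hy)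
    (one_lt_val_of_root hz₀ hz₀1 hy') hz).2

/-- **The approximate root.** With `u = 1 - a₁z₀ - a₂z₀²` (a unit) and `|z₀| < 1`: the monic
cubic `G(v) = v³ + uv² + t z₀³ v - a₆ z₀⁶` has `|G(-u)| ≤ |z₀|³ < 1`, and every `v` with
`|v + u| < 1` has `|v| = 1` (so a root of `G` near `-u` gives `y = v/z₀³` with `|y||z₀|³ = 1`).
[folklore] -/
theorem approxRoot {z₀ : F} (hz₀1 : w z₀ < 1) :
    w (1 - V.a₁ * z₀ - V.a₂ * z₀ ^ 2) = 1 ∧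
    w ((-(1 - V.a₁ * z₀ - V.a₂ * z₀ ^ 2)) ^ 3
        + (1 - V.a₁ * z₀ - V.a₂ * z₀ ^ 2) * (-(1 - V.a₁ * z₀ - V.a₂ * z₀ ^ 2)) ^ 2
        + (V.a₃ + V.a₄ * z₀) * z₀ ^ 3 * (-(1 - V.a₁ * z₀ - V.a₂ * z₀ ^ 2)) - V.a₆ * z₀ ^ 6)
      ≤ w z₀ ^ 3 ∧
    ∀ v : F, w (v + (1 - V.a₁ * z₀ - V.a₂ * z₀ ^ 2)) < 1 → w v = 1 := by
  have ha₁ : w V.a₁ ≤ 1 := val_a₁_le_one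
  have ha₂ : w V.a₂ ≤ 1 := val_a₂_le_one
  have ha₃ : w V.a₃ ≤ 1 := val_a₃_le_one
  have ha₄ : w V.a₄ ≤ 1 := val_a₄_le_one
  have ha₆ : w V.a₆ ≤ 1 := val_a₆_le_one
  have hz1 : w z₀ ≤ 1 := hz₀1.le
  set u := 1 - V.a₁ * z₀ - V.a₂ * z₀ ^ 2 with hu
  have hu1 : w (u - 1) < 1 := by
    have : u - 1 = -(V.a₁ * z₀ + V.a₂ * z₀ ^ 2) := by rw [hu]; ring
    rw [this, Valuation.map_neg]
    refine w.map_add_lt ?_ ?_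
    · calc w (V.a₁ * z₀) ≤ 1 * w z₀ := val_mul_le w ha₁ le_rfl
        _ = w z₀ := one_mul _
        _ < 1 := hz₀1
    · calc w (V.a₂ * z₀ ^ 2) ≤ 1 * w z₀ ^ 2 := val_mul_le w ha₂ (by rw [map_pow])
        _ = w z₀ ^ 2 := one_mul _
        _ < 1 := pow_lt_one₀ zero_le hz₀1 two_ne_zero
  have huw : w u = 1 := val_eq_one_of_val_sub_one_lt w hu1
  refine ⟨huw, ?_, fun v hv ↦ ?_⟩
  · have : (-u) ^ 3 + u * (-u) ^ 2 + (V.a₃ + V.a₄ * z₀) * z₀ ^ 3 * (-u) - V.a₆ * z₀ ^ 6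
        = -((V.a₃ + V.a₄ * z₀) * u) * z₀ ^ 3 + -(V.a₆ * z₀ ^ 3) * z₀ ^ 3 := by ring
    rw [this]
    refine w.map_add_le ?_ ?_
    · rw [map_mul, map_pow, Valuation.map_neg]
      calc w ((V.a₃ + V.a₄ * z₀) * u) * w z₀ ^ 3 ≤ 1 * w z₀ ^ 3 := by
            gcongr
            calc w ((V.a₃ + V.a₄ * z₀) * u) ≤ 1 * 1 :=
                val_mul_le w (w.map_add_le ha₃ (by
                  simpa only [one_mul] using val_mul_le w ha₄ hz1)) huw.le
              _ = 1 := one_mul _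
        _ = w z₀ ^ 3 := one_mul _
    · rw [map_mul, map_pow, Valuation.map_neg]
      calc w (V.a₆ * z₀ ^ 3) * w z₀ ^ 3 ≤ 1 * w z₀ ^ 3 := by
            gcongr
            calc w (V.a₆ * z₀ ^ 3) ≤ 1 * 1 := val_mul_le w ha₆ (by
                  rw [map_pow]; exact pow_le_one₀ zero_le hz1)
              _ = 1 := one_mul _
        _ = w z₀ ^ 3 := one_mul _
  · have : v = (v + u) + -u := by ring
    rw [this, w.map_add_eq_of_lt_right (by rwa [Valuation.map_neg, huw]), Valuation.map_neg, huw]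

end Roots

end FormalGroupChart

end Literature.NumberTheory.EllipticCurves
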